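import Literature.NumberTheory.Sieve.IwaniecAlmostPrimesWeightedSum
import HarnessLib

/-!
# Iwaniec (1978), §5: the proof of Proposition 2 — interface of Lemma 2, classes, main terms

H. Iwaniec, *Almost-primes represented by quadratic polynomials*, Invent. Math. **47** (1978)
171–188 [cite: IwaniecInventiones1978, §5 pp. 185–186].  Proposition 2 (p. 185) is "almost
immediate consequence of Lemma 2 and Corollary of Proposition 1"; this file supplies, fully proved,
everything that the derivation needs apart from the two named inputs themselves
(`lemma2_bilinearSieve`, `proposition1_corollary`) and Mertens' theorem for `ρ` (proved in
`IwaniecAlmostPrimesMertens.lean` and consumed here as explicit hypotheses `hK`, `hM2`).  The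
assembly (`proposition2_upper_of`, `proposition2_lower_const_of`) is the sequel
`IwaniecAlmostPrimesProp2.lean`.  Contents (all PROVED):

* **`ℬ = 𝒜_q`** (p. 185, (21)): `multisetAq`, `msifted_multisetAq` (`S(ℬ, u) = siftedCount x q u`),
  `mcount_multisetAq_of_coprime`, `rem_mul_eq_of_coprime` (`r(ℬ, d) = r(𝒜; qd)` for `(q, d) = 1`,
  `X = ρ(q) x/q`), `rho_mul_of_coprime` (CRT), `rhoArith` (multiplicative), `rho_primePow_le_two`,
  `rho_condition_two` (condition (2) of Lemma 2 for `ω = ρ`, `L = 9`), and the packaged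
  application **`lemma2_multisetAq`** of `lemma2_bilinearSieve` to `𝒜_q`;
* **classes** (p. 185 `H(Q, Z)`, p. 186 "the number of disjoint classes … less than `4(log x)²`"):
  `mul_injOn_rough_smooth` (`(q, m) ↦ qm` injective for `q` rough, `m ∣ P(u)`),
  `mul_dvd_squarefree_iff`, `remainder_eq_sum_bilinearB`, **`abs_remainder_class_le`** (the
  bilinear remainders of a class are `≤ ∑_{m'<x^{1−4ε'}} |B(x; m', N)|`, ready for the Corollary of
  Proposition 1), `indicator_coeff_admissible`, `dyadicFloor_spec`, `le_floor_logb_of_pow_le`,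
  `floor_logb_le`, `eventually_classes_remainder_le`, `eventually_E_small`;
* **sieve functions**: `lipschitzOnWith_Icc_of_split`, `lipschitzOnWith_of_hasDerivAt_Ioo` (MVT),
  `IsLinearSieveFunctions.exists_bound_upper/lower`, `exists_lipschitzOnWith_upper`,
  `exists_lipschitzOnWith_mul_upper` (`s F(s)` is `C¹`), `exists_lipschitzOnWith_lower` (`f` has a
  corner at `s = 2`; glued), **`IsLinearSieveFunctions.nonneg`** (`F, f ≥ 0` on `(0, ∞)` by forward
  stepping), `siftedCount_anti` (monotonicity in the level, p. 185);
* **densities**: `densityProd_pos`, `lambda0` (`= 2Γe^{-γ}`), `lambda0_pos`,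
  `eventually_forall_abs_densityProd_mul_log_sub_le` (uniform form of `V(t) log t → Λ₀`, p. 186
  "`V(Z) = V(z)(log z/log z_q)(1 + O(1/log z))`"), `rhoDivArith`,
  **`eventually_sum_rough_rho_div_le`** (`∑_{q<x, (q,P(x^γ))=1} ρ(q)/q ≤ e²/γ`, the implicit
  `O_γ(1)` factor of the `O_γ(ε)` in Proposition 2), `siftedCount_eq_zero_of_rho_eq_zero`;
* **main terms of a single `q`** (p. 186 "`F(log(y/Qx^{2ε})/log Z) = F(log(y/q)/log z_q) + O_γ(ε)`"):
  **`main_term_upper`** (level `u = min(Z_c, (MN)^{1/2})`; for `u = (MN)^{1/2}` both arguments lie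
  in `(0, 3]` where `s F(s) = A`), `densityProd_level_le` (absorbs Lemma 2's `E`),
  **`main_term_lower`**, `main_term_lower_trivial` (constant level; `Z > (MN)^{1/2}` is trivial).

## References

* H. Iwaniec, Invent. Math. 47 (1978) 171–188, §5 (`IwaniecInventiones1978`).
* H. Iwaniec, Acta Arith. 37 (1980) 307–320, Theorem 1 and conditions (1), (2)
  (`IwaniecActaArith1980b`).
-/

open Finset Real Polynomial Filter
open scoped Topology

noncomputable section

namespace Literature.NumberTheory.Sieve.Iwaniec1978

/-- `𝒜_q = {n² + 1 : 1 ≤ n ≤ x, q ∣ n² + 1}` as a multiset of integers (the `ℬ` fed to Lemma 2 on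
p. 185). [cite: IwaniecInventiones1978, §5 p. 185] -/
def multisetAq (x : ℝ) (q : ℕ) : Multiset ℤ :=
  (((Finset.Icc 1 ⌊x⌋₊).filter fun n : ℕ => q ∣ n ^ 2 + 1).val.map fun n : ℕ => ((n ^ 2 + 1 : ℕ) : ℤ))

/-- `S(𝒜_q, u)` in the multiset interface equals `siftedCount x q u`. [folklore] -/
theorem msifted_multisetAq (x : ℝ) (q : ℕ) (u : ℝ) :
    msifted (multisetAq x q) u = siftedCount x q u := by
  unfold msifted multisetAq siftedCount
  rw [Multiset.filter_map, Multiset.card_map, ← Finset.filter_val, Finset.card_val,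
    Finset.filter_filter]
  congr 1

/-- `|(𝒜_q)_d| = #{1 ≤ n ≤ x : q ∣ n² + 1, d ∣ n² + 1}`. [folklore] -/
theorem mcount_multisetAq (x : ℝ) (q d : ℕ) :
    mcount (multisetAq x q) d =
      ((Finset.Icc 1 ⌊x⌋₊).filter fun n : ℕ => q ∣ n ^ 2 + 1 ∧ d ∣ n ^ 2 + 1).card := by
  unfold mcount multisetAq
  rw [Multiset.filter_map, Multiset.card_map, ← Finset.filter_val, Finset.card_val,
    Finset.filter_filter]
  congr 1
  refine Finset.filter_congr fun n _ => ?_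
  simp only [Function.comp]
  exact and_congr_right fun _ => by exact_mod_cast Int.natCast_dvd_natCast

/-- For `(q, d) = 1`: `|(𝒜_q)_d| = |𝒜_{qd}| = congrCount x (q d)`. [folklore] -/
theorem mcount_multisetAq_of_coprime (x : ℝ) {q d : ℕ} (h : q.Coprime d) :
    mcount (multisetAq x q) d = congrCount x (q * d) := by
  rw [mcount_multisetAq, congrCount]
  congr 1
  refine Finset.filter_congr fun n _ => ?_
  constructor
  · rintro ⟨hq, hd⟩; exact h.mul_dvd_of_dvd_of_dvd hq hd
  · intro hqd; exact ⟨dvd_trans (dvd_mul_right q d) hqd, dvd_trans (dvd_mul_left d q) hqd⟩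
/-- `ρ(d)` counts the roots of `X² + 1` in `ZMod d` (`d ≠ 0`). [folklore] -/
theorem rho_eq_card_filter_zmod {d : ℕ} [NeZero d] :
    rho d = (Finset.univ.filter fun x : ZMod d => x ^ 2 + 1 = 0).card := by
  unfold rho
  refine Finset.card_bij (fun ν _ => (ν : ZMod d)) ?_ ?_ ?_
  · intro ν hν
    rw [Finset.mem_filter] at hν ⊢
    refine ⟨Finset.mem_univ _, ?_⟩
    have : ((ν ^ 2 + 1 : ℕ) : ZMod d) = 0 := (ZMod.natCast_eq_zero_iff _ _).mpr hν.2
    push_cast at this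
    exact this
  · intro a ha b hb hab
    have ha' := Finset.mem_range.mp (Finset.mem_filter.mp ha).1
    have hb' := Finset.mem_range.mp (Finset.mem_filter.mp hb).1
    have := (ZMod.natCast_eq_natCast_iff' a b d).mp hab
    rwa [Nat.mod_eq_of_lt ha', Nat.mod_eq_of_lt hb'] at this
  · intro x hx
    rw [Finset.mem_filter] at hx
    refine ⟨x.val, ?_, ZMod.natCast_zmod_val x⟩
    rw [Finset.mem_filter, Finset.mem_range]
    refine ⟨ZMod.val_lt x, ?_⟩
    rw [← ZMod.natCast_eq_zero_iff]
    push_cast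
    rw [ZMod.natCast_zmod_val]
    exact hx.2

/-- **Multiplicativity of `ρ`** on coprime arguments (Chinese remainder theorem), used on p. 176
("ρ is multiplicative") and for `ℬ = 𝒜_q` in §5. [cite: IwaniecInventiones1978, §4 p. 176] -/
theorem rho_mul_of_coprime {m n : ℕ} (hm : m ≠ 0) (hn : n ≠ 0) (h : m.Coprime n) :
    rho (m * n) = rho m * rho n := by
  haveI : NeZero m := ⟨hm⟩
  haveI : NeZero n := ⟨hn⟩
  haveI : NeZero (m * n) := ⟨mul_ne_zero hm hn⟩
  rw [rho_eq_card_filter_zmod, rho_eq_card_filter_zmod, rho_eq_card_filter_zmod,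
    ← Finset.card_product]
  let e := ZMod.chineseRemainder h
  refine Finset.card_bij (fun x _ => e x) ?_ ?_ ?_
  · intro x hx
    rw [Finset.mem_filter] at hx
    rw [Finset.mem_product, Finset.mem_filter, Finset.mem_filter]
    have h1 : e (x ^ 2 + 1) = 0 := by rw [hx.2, map_zero]
    rw [map_add, map_pow, map_one] at h1
    have h2 := Prod.ext_iff.mp h1
    exact ⟨⟨Finset.mem_univ _, h2.1⟩, ⟨Finset.mem_univ _, h2.2⟩⟩
  · intro a _ b _ hab
    exact e.injective hab
  · intro y hy
    rw [Finset.mem_product, Finset.mem_filter, Finset.mem_filter] at hy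
    refine ⟨e.symm y, ?_, by simp [e]⟩
    rw [Finset.mem_filter]
    refine ⟨Finset.mem_univ _, ?_⟩
    apply e.injective
    rw [map_add, map_pow, map_one, map_zero]
    simp only [e, RingEquiv.apply_symm_apply]
    exact Prod.ext hy.1.2 hy.2.2

/-- If `p^a ∣ x² + 1` and `p^a ∣ y² + 1` (`p` prime, `a ≥ 1`) then `x ≡ ±y (mod p^a)`. [folklore] -/
theorem primePow_dvd_sub_or_add {p a x y : ℕ} (hp : p.Prime) (ha : 1 ≤ a)
    (hx : p ^ a ∣ x ^ 2 + 1) (hy : p ^ a ∣ y ^ 2 + 1) :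
    ((p : ℤ) ^ a ∣ (x : ℤ) - y) ∨ ((p : ℤ) ^ a ∣ (x : ℤ) + y) := by
  have hx' : (p : ℤ) ^ a ∣ (x : ℤ) ^ 2 + 1 := by exact_mod_cast hx
  have hy' : (p : ℤ) ^ a ∣ (y : ℤ) ^ 2 + 1 := by exact_mod_cast hy
  have hprod : (p : ℤ) ^ a ∣ ((x : ℤ) - y) * ((x : ℤ) + y) := by
    have e : ((x : ℤ) - y) * ((x : ℤ) + y) = ((x : ℤ) ^ 2 + 1) - ((y : ℤ) ^ 2 + 1) := by ring
    rw [e]; exact dvd_sub hx' hy'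
  have hpi : Prime (p : ℤ) := Nat.prime_iff_prime_int.mp hp
  have hpa : (p : ℤ) ∣ (p : ℤ) ^ a := dvd_pow_self _ (by omega)
  by_cases h1 : (p : ℤ) ∣ (x : ℤ) - y
  · by_cases h2 : (p : ℤ) ∣ (x : ℤ) + y
    · -- then `p ∣ 2x`, so `p = 2` (as `p ∤ x`), and `a = 1` since `4 ∤ x² + 1`
      have h2x : (p : ℤ) ∣ 2 * x := by
        have e : (2 * x : ℤ) = ((x : ℤ) - y) + ((x : ℤ) + y) := by ring
        rw [e]; exact dvd_add h1 h2
      have hpx2 : (p : ℤ) ∣ (x : ℤ) ^ 2 + 1 := hpa.trans hx'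
      rcases hpi.dvd_or_dvd h2x with h2' | hpx
      · have hp2 : p = 2 := by
          have : p ∣ 2 := by exact_mod_cast h2'
          exact (Nat.prime_dvd_prime_iff_eq hp Nat.prime_two).mp this
        subst hp2
        have ha1 : a = 1 := by
          by_contra hne
          have ha2 : 2 ≤ a := by omega
          have h4 : (4 : ℕ) ∣ x ^ 2 + 1 := (pow_dvd_pow 2 ha2).trans hx
          have hz : ((x ^ 2 + 1 : ℕ) : ZMod 4) = 0 := (ZMod.natCast_eq_zero_iff _ 4).mpr h4
          push_cast at hz
          revert hz
          generalize (x : ZMod 4) = t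
          revert t
          decide
        subst ha1
        left
        simpa using h1
      · exfalso
        have h1' : (p : ℤ) ∣ 1 := by
          have h := dvd_sub hpx2 (dvd_mul_of_dvd_right hpx (x : ℤ))
          have e : ((x : ℤ) ^ 2 + 1) - (x : ℤ) * x = 1 := by ring
          rwa [e] at h
        exact hpi.not_dvd_one h1'
    · left
      have hcop : IsCoprime ((p : ℤ) ^ a) ((x : ℤ) + y) :=
        ((Prime.coprime_iff_not_dvd hpi).mpr h2).pow_left
      exact hcop.dvd_of_dvd_mul_right hprod
  · right
    have hcop : IsCoprime ((p : ℤ) ^ a) ((x : ℤ) - y) :=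
      ((Prime.coprime_iff_not_dvd hpi).mpr h1).pow_left
    exact hcop.dvd_of_dvd_mul_left hprod

/-- `ρ(p^a) ≤ 2` for every prime power (`a ≥ 1`) (condition (2) of Lemma 2 for `ω = ρ`). [folklore] -/
theorem rho_primePow_le_two {p a : ℕ} (hp : p.Prime) (ha : 1 ≤ a) : rho (p ^ a) ≤ 2 := by
  unfold rho
  set S := (Finset.range (p ^ a)).filter fun ν : ℕ => p ^ a ∣ ν ^ 2 + 1 with hS
  rcases S.eq_empty_or_nonempty with h0 | ⟨x₀, hx₀⟩
  · rw [h0]; simp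
  have hx₀' := (Finset.mem_filter.mp hx₀)
  have hq0 : 0 < p ^ a := pow_pos hp.pos a
  -- every root is `x₀` or `p^a - x₀` (reduced)
  have hsub : S ⊆ {x₀, (p ^ a - x₀) % (p ^ a)} := by
    intro y hy
    have hy' := Finset.mem_filter.mp hy
    have hylt := Finset.mem_range.mp hy'.1
    have hxlt := Finset.mem_range.mp hx₀'.1
    rw [Finset.mem_insert, Finset.mem_singleton]
    rcases primePow_dvd_sub_or_add hp ha hy'.2 hx₀'.2 with h | h
    · left
      -- `p^a ∣ y - x₀` with both in `[0, p^a)` forces equality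
      have hlt : |(y : ℤ) - x₀| < (p : ℤ) ^ a := by
        rw [abs_sub_lt_iff]
        constructor <;>
          linarith [(by exact_mod_cast hylt : (y : ℤ) < (p : ℤ) ^ a),
            (by exact_mod_cast hxlt : (x₀ : ℤ) < (p : ℤ) ^ a),
            (by positivity : (0 : ℤ) ≤ y), (by positivity : (0 : ℤ) ≤ x₀)]
      have h0 := Int.eq_zero_of_abs_lt_dvd h hlt
      have : (y : ℤ) = x₀ := by linarith
      exact_mod_cast this
    · right
      -- `p^a ∣ y + x₀`: then `y ≡ -x₀ ≡ p^a - x₀ (mod p^a)`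
      have hdiv : (p ^ a : ℕ) ∣ y + x₀ := by exact_mod_cast h
      have : y % (p ^ a) = (p ^ a - x₀) % (p ^ a) := by
        have hle : x₀ ≤ p ^ a := hxlt.le
        obtain ⟨k, hk⟩ := hdiv
        have : y + x₀ + (p ^ a - x₀) = p ^ a * k + (p ^ a - x₀) := by rw [hk]
        have e : y + p ^ a = p ^ a * k + (p ^ a - x₀) := by omega
        calc y % (p ^ a) = (y + p ^ a) % (p ^ a) := by rw [Nat.add_mod_right]
          _ = (p ^ a * k + (p ^ a - x₀)) % (p ^ a) := by rw [e]
          _ = (p ^ a - x₀) % (p ^ a) := by rw [Nat.mul_add_mod]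
      rw [← this, Nat.mod_eq_of_lt hylt]
  calc S.card ≤ ({x₀, (p ^ a - x₀) % (p ^ a)} : Finset ℕ).card := Finset.card_le_card hsub
    _ ≤ 2 := Finset.card_le_two

/-- **The remainder of `ℬ = 𝒜_q` in Lemma 2's normalisation:** for `(q, d) = 1`, `q, d ≠ 0`,
`r(ℬ, d) = |ℬ_d| − (ρ(d)/d) X` with `X = ρ(q) x/q` equals `r(𝒜; qd)` (p. 185: "so as to have
`r(ℬ, d) = r(𝒜_q, d) = r(𝒜, qd)`"). [cite: IwaniecInventiones1978, §5 p. 185] -/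
theorem rem_mul_eq_of_coprime (x : ℝ) {q d : ℕ} (hq : q ≠ 0) (hd : d ≠ 0) (h : q.Coprime d) :
    rem x (q * d) = (mcount (multisetAq x q) d : ℝ) - (rho d : ℝ) / d * ((rho q : ℝ) * x / q) := by
  rw [rem, mcount_multisetAq_of_coprime x h, rho_mul_of_coprime hq hd h]
  have hq' : (q : ℝ) ≠ 0 := by exact_mod_cast hq
  have hd' : (d : ℝ) ≠ 0 := by exact_mod_cast hd
  push_cast
  field_simp

/-- **Injectivity of `(q, m) ↦ qm` within a class** (p. 185–186): if `m ∣ P(Z)` and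
`(q, P(Z)) = 1` then `m = gcd(qm, P(Z))`, so the pair is determined by the product. [folklore] -/
theorem eq_gcd_mul_primesProdBelow {q m : ℕ} {Z : ℝ} (hm : m ∣ primesProdBelow Z)
    (hq : q.Coprime (primesProdBelow Z)) : m = Nat.gcd (q * m) (primesProdBelow Z) := by
  rw [Nat.Coprime.gcd_mul_left_cancel m hq]
  exact (Nat.gcd_eq_left hm).symm

/-- The map `(q, m) ↦ q m` is injective on pairs with `m ∣ P(Z)`, `(q, P(Z)) = 1`. [folklore] -/
theorem mul_injOn_rough_smooth (Z : ℝ) :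
    Set.InjOn (fun qm : ℕ × ℕ => qm.1 * qm.2)
      {qm : ℕ × ℕ | qm.2 ∣ primesProdBelow Z ∧ qm.1.Coprime (primesProdBelow Z)} := by
  rintro ⟨q, m⟩ ⟨hm, hq⟩ ⟨q', m'⟩ ⟨hm', hq'⟩ heq
  simp only at heq hm hq hm' hq'
  have hmm : m = m' := by
    rw [eq_gcd_mul_primesProdBelow hm hq, eq_gcd_mul_primesProdBelow hm' hq', heq]
  subst hmm
  have hm0 : m ≠ 0 := by
    rintro rfl
    exact primesProdBelow_ne_zero Z (zero_dvd_iff.mp hm)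
  have : q = q' := Nat.eq_of_mul_eq_mul_right (Nat.pos_of_ne_zero hm0) heq
  subst this
  rfl

/-! ### `ρ` as a multiplicative arithmetic function and condition (2) of Lemma 2 -/

/-- `ρ(0) = 0`. [folklore] -/
theorem rho_zero : rho 0 = 0 := by simp [rho]

/-- `ρ` as a real arithmetic function (the `ω` of Lemma 2 for `ℬ = 𝒜_q`). [folklore] -/
def rhoArith : ArithmeticFunction ℝ := ⟨fun n => (rho n : ℝ), by simp [rho_zero]⟩

/-- `rhoArith n = ρ(n)`. [folklore] -/
@[simp] theorem rhoArith_apply (n : ℕ) : rhoArith n = (rho n : ℝ) := rfl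

/-- `ρ` is multiplicative. [cite: IwaniecInventiones1978, §4 p. 176] -/
theorem isMultiplicative_rhoArith : ArithmeticFunction.IsMultiplicative rhoArith := by
  refine ⟨by simp [rhoArith_apply, rho_one], fun {m n} h => ?_⟩
  simp only [rhoArith_apply]
  rcases Nat.eq_zero_or_pos m with rfl | hm
  · simp [rho_zero]
  rcases Nat.eq_zero_or_pos n with rfl | hn
  · simp [rho_zero]
  exact_mod_cast rho_mul_of_coprime hm.ne' hn.ne' h

/-- `0 ≤ ρ(n)`. [folklore] -/
theorem rhoArith_nonneg (n : ℕ) : 0 ≤ rhoArith n := by simp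

/-- `ρ(p) < p` for a prime `p` (`ρ(2) = 1`, `ρ(p) ≤ 2 < p` otherwise). [folklore] -/
theorem rhoArith_lt_prime {p : ℕ} (hp : p.Prime) : rhoArith p < p := by
  simp only [rhoArith_apply]
  rcases hp.eq_two_or_odd with rfl | hodd
  · have : rho 2 = 1 := by decide
    rw [this]; norm_num
  · have h2 := rho_le_two hp
    have h3 : 3 ≤ p := by have := hp.two_le; omega
    calc (rho p : ℝ) ≤ 2 := by exact_mod_cast h2
      _ < p := by exact_mod_cast (by omega : 2 < p)

/-- Inner geometric tail: `∑_{2 ≤ a ≤ A} ρ(p^a)/p^a ≤ 4/p²` for a prime `p`. [folklore] -/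
theorem sum_rho_primePow_div_le {p : ℕ} (hp : p.Prime) (A : ℕ) :
    ∑ a ∈ Finset.Icc 2 A, (rhoArith (p ^ a)) / (p : ℝ) ^ a ≤ 4 / (p : ℝ) ^ 2 := by
  have hp2 : (2 : ℝ) ≤ p := by exact_mod_cast hp.two_le
  have hp0 : (0 : ℝ) < p := by linarith
  -- `ρ(p^a) ≤ 2` and `∑_{a=2}^{A} p^{-a} ≤ 2 p^{-2}`
  have h1 : ∀ a ∈ Finset.Icc 2 A, (rhoArith (p ^ a)) / (p : ℝ) ^ a ≤ 2 * ((p : ℝ)⁻¹) ^ a := by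
    intro a ha
    rw [Finset.mem_Icc] at ha
    have hρ : (rho (p ^ a) : ℝ) ≤ 2 := by exact_mod_cast rho_primePow_le_two hp (by omega)
    rw [rhoArith_apply, inv_pow, div_eq_mul_inv]
    exact mul_le_mul_of_nonneg_right hρ (by positivity)
  refine (Finset.sum_le_sum h1).trans ?_
  rw [← Finset.mul_sum]
  -- geometric sum bound: `∑_{a ∈ Icc 2 A} r^a ≤ r^2 / (1 - r) ≤ 2 r^2` with `r = 1/p ≤ 1/2`
  set r : ℝ := (p : ℝ)⁻¹ with hr
  have hr0 : 0 ≤ r := by positivity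
  have hr1 : r ≤ 1 / 2 := by rw [hr, inv_le_comm₀ hp0 (by norm_num)]; norm_num; exact_mod_cast hp2
  have hgeom : ∑ a ∈ Finset.Icc 2 A, r ^ a ≤ 2 * r ^ 2 := by
    have hsub : Finset.Icc 2 A ⊆ Finset.range (A + 1) := fun a ha => by
      rw [Finset.mem_Icc] at ha; rw [Finset.mem_range]; omega
    have hsplit : ∑ a ∈ Finset.Icc 2 A, r ^ a = ∑ a ∈ Finset.range (A + 1), r ^ a -
        ∑ a ∈ Finset.range (A + 1) \ Finset.Icc 2 A, r ^ a := by
      rw [← Finset.sum_sdiff hsub]; ring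
    have hge : (1 : ℝ) + r ≤ ∑ a ∈ Finset.range (A + 1) \ Finset.Icc 2 A, r ^ a ∨ A < 2 := by
      by_cases hA : 2 ≤ A
      · left
        have h01 : ({0, 1} : Finset ℕ) ⊆ Finset.range (A + 1) \ Finset.Icc 2 A := by
          intro a ha
          rw [Finset.mem_insert, Finset.mem_singleton] at ha
          rw [Finset.mem_sdiff, Finset.mem_range, Finset.mem_Icc]
          rcases ha with rfl | rfl <;> omega
        calc (1 : ℝ) + r = ∑ a ∈ ({0, 1} : Finset ℕ), r ^ a := by simp
          _ ≤ _ := Finset.sum_le_sum_of_subset_of_nonneg h01 fun _ _ _ => by positivity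
      · right; omega
    rcases hge with hge | hA
    · have htot : ∑ a ∈ Finset.range (A + 1), r ^ a ≤ 1 / (1 - r) := by
        have := geom_sum_Ico_le_of_lt_one hr0 (by linarith : r < 1) (m := 0) (n := A + 1)
        simpa using this
      rw [hsplit]
      have h2 : 1 / (1 - r) ≤ 1 + r + 2 * r ^ 2 := by
        rw [div_le_iff₀ (by linarith)]; nlinarith
      linarith
    · rw [Finset.Icc_eq_empty (by omega)]; simp; positivity
  calc 2 * ∑ a ∈ Finset.Icc 2 A, r ^ a ≤ 2 * (2 * r ^ 2) := by linarith
    _ = 4 / (p : ℝ) ^ 2 := by rw [hr, inv_pow]; ring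

/-- **Condition (2) of Lemma 2 for `ω = ρ`** with `L = 9`: for `2 ≤ w < z` and every `A`,
`∑_{w ≤ p < z} ∑_{2 ≤ a ≤ A} ρ(p^a)/p^a ≤ 9 / log(3w)`. [cite: IwaniecActaArith1980b, §1 (2)] -/
theorem rho_condition_two (w z : ℝ) (hw : 2 ≤ w) (_hwz : w < z) (A : ℕ) :
    ∑ p ∈ (Nat.primesBelow ⌈z⌉₊).filter (fun p : ℕ => w ≤ (p : ℝ)),
        ∑ a ∈ Finset.Icc 2 A, rhoArith (p ^ a) / (p : ℝ) ^ a ≤ 9 / Real.log (3 * w) := by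
  set S := (Nat.primesBelow ⌈z⌉₊).filter (fun p : ℕ => w ≤ (p : ℝ)) with hS
  have h1 : ∑ p ∈ S, ∑ a ∈ Finset.Icc 2 A, rhoArith (p ^ a) / (p : ℝ) ^ a ≤
      ∑ p ∈ S, 4 / (p : ℝ) ^ 2 :=
    Finset.sum_le_sum fun p hp => sum_rho_primePow_div_le (Nat.mem_primesBelow.mp
      (Finset.mem_filter.mp hp).1).2 A
  refine h1.trans ?_
  -- `∑_{p ∈ S} 4/p² ≤ 4 ∑_{k < i ≤ N} 1/i² ≤ 4/k` with `k = ⌈w⌉₊ - 1 ≥ 1`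
  set k := ⌈w⌉₊ - 1 with hk
  have hceil2 : 2 ≤ ⌈w⌉₊ := by
    have : (2 : ℝ) ≤ ⌈w⌉₊ := hw.trans (Nat.le_ceil w); exact_mod_cast this
  have hk1 : 1 ≤ k := by omega
  have hkw : w - 1 ≤ (k : ℝ) := by
    have h1 : (k : ℝ) = (⌈w⌉₊ : ℝ) - 1 := by
      rw [hk, Nat.cast_sub (by omega : 1 ≤ ⌈w⌉₊), Nat.cast_one]
    rw [h1]; linarith [Nat.le_ceil w]
  have hsub : S ⊆ Finset.Ioc k (max k ⌈z⌉₊) := by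
    intro p hp
    rw [Finset.mem_filter, Nat.mem_primesBelow] at hp
    rw [Finset.mem_Ioc]
    constructor
    · have : ⌈w⌉₊ ≤ p := Nat.ceil_le.mpr hp.2
      omega
    · exact le_max_of_le_right hp.1.1.le
  have h2 : ∑ p ∈ S, 4 / (p : ℝ) ^ 2 ≤ 4 * ((k : ℝ)⁻¹) := by
    calc ∑ p ∈ S, 4 / (p : ℝ) ^ 2 = 4 * ∑ p ∈ S, ((p : ℝ) ^ 2)⁻¹ := by
          rw [Finset.mul_sum]; refine Finset.sum_congr rfl fun p _ => by ring
      _ ≤ 4 * ∑ i ∈ Finset.Ioc k (max k ⌈z⌉₊), ((i : ℝ) ^ 2)⁻¹ :=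
          mul_le_mul_of_nonneg_left
            (Finset.sum_le_sum_of_subset_of_nonneg hsub fun i _ _ => by positivity) (by norm_num)
      _ ≤ 4 * ((k : ℝ)⁻¹ - ((max k ⌈z⌉₊ : ℕ) : ℝ)⁻¹) :=
          mul_le_mul_of_nonneg_left (sum_Ioc_inv_sq_le_sub (by omega) (le_max_left _ _))
            (by norm_num)
      _ ≤ 4 * ((k : ℝ)⁻¹) :=
          mul_le_mul_of_nonneg_left (sub_le_self _ (by positivity)) (by norm_num)
  refine h2.trans ?_
  -- `4/k ≤ 4/(w-1) ≤ 9/log(3w)` since `log(3w) ≤ log 3 + (w - 1) ≤ w + 0.1`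
  have hlog3 : Real.log 3 < 1.0987 := by
    have := Real.log_two_lt_d9
    have h := Real.abs_log_sub_add_sum_range_le (show |(1 / 3 : ℝ)| < 1 by norm_num) 18
    rw [abs_le] at h
    norm_num [Finset.sum_range_succ] at h
    have e : Real.log (2 / 3) = Real.log 2 - Real.log 3 := by
      rw [Real.log_div (by norm_num) (by norm_num)]
    rw [e] at h
    linarith [h.1, h.2]
  have hlogw : Real.log (3 * w) ≤ w + 0.1 := by
    rw [Real.log_mul (by norm_num) (by linarith)]
    have := Real.log_le_sub_one_of_pos (by linarith : 0 < w)
    linarith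
  have hlogpos : 0 < Real.log (3 * w) := Real.log_pos (by linarith)
  rw [le_div_iff₀ hlogpos]
  have hk0 : (0 : ℝ) < k := by exact_mod_cast hk1
  rw [show 4 * (k : ℝ)⁻¹ * Real.log (3 * w) = 4 * Real.log (3 * w) / k by ring,
    div_le_iff₀ hk0]
  nlinarith


/-! ### Monotonicity of the sifting function in the sifting level -/

/-- `P(u) ∣ P(u')` for `u ≤ u'`. [folklore] -/
theorem primesProdBelow_dvd_of_le {u u' : ℝ} (h : u ≤ u') : primesProdBelow u ∣ primesProdBelow u' := by
  unfold primesProdBelow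
  refine Finset.prod_dvd_prod_of_subset _ _ _ fun p hp => ?_
  rw [Nat.mem_primesBelow] at hp ⊢
  exact ⟨lt_of_lt_of_le hp.1 (Nat.ceil_le_ceil h), hp.2⟩

/-- **`S(𝒜_q, u)` is non-increasing in `u`** (used twice on p. 185: `S(𝒜_q, z_q) ≤ S(𝒜_q, Z)` for
`Z ≤ z_q`, and the `s < 2` reduction to `z' = (MN)^{1/2}`). [cite: IwaniecInventiones1978, §5 p. 185] -/
theorem siftedCount_anti (x : ℝ) (q : ℕ) {u u' : ℝ} (h : u ≤ u') :
    siftedCount x q u' ≤ siftedCount x q u := by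
  unfold siftedCount
  refine Finset.card_le_card fun n hn => ?_
  rw [Finset.mem_filter] at hn ⊢
  exact ⟨hn.1, hn.2.1, Nat.Coprime.coprime_dvd_right (primesProdBelow_dvd_of_le h) hn.2.2⟩

/-! ### `F` is Lipschitz on compact subintervals of `(0, ∞)` -/

/-- **`F` is Lipschitz on `[a, b]`, `a > 0`** (from its `C¹` regularity, first file): the input for
replacing `F(log(MN)/log Z)` by `F(log(y/q)/log z_q)` at the cost `O(ε)` in the proof of
Proposition 2 (p. 186: "`F(log(y/Qx^{2ε})/log Z) = F(log(y/q)/log z_q) + O_γ(ε)`").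
[cite: IwaniecInventiones1978, §5 p. 186] -/
theorem IsLinearSieveFunctions.exists_lipschitzOnWith_upper {F f : ℝ → ℝ}
    (h : IsLinearSieveFunctions F f) {a b : ℝ} (ha : 0 < a) :
    ∃ K, LipschitzOnWith K F (Set.Icc a b) := by
  -- bound the derivative on the compact interval
  have hcont : ContinuousOn (fun t : ℝ => (IsLinearSieveFunctions.mulUpperDeriv f t - F t) / t)
      (Set.Icc a b) :=
    h.continuousOn_upperDeriv.mono fun t ht => lt_of_lt_of_le ha ht.1
  obtain ⟨C, hC⟩ := isCompact_Icc.exists_bound_of_continuousOn hcont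
  set C' := max C 0 with hC'
  refine ⟨⟨C', le_max_right _ _⟩, ?_⟩
  refine (convex_Icc a b).lipschitzOnWith_of_nnnorm_hasDerivWithin_le (f := F)
    (f' := fun t => (IsLinearSieveFunctions.mulUpperDeriv f t - F t) / t)
    (fun t ht => ?_) (fun t ht => ?_)
  · exact (h.hasDerivAt_upper' (lt_of_lt_of_le ha ht.1)).hasDerivWithinAt
  · have := (hC t ht).trans (le_max_left C 0)
    rw [← NNReal.coe_le_coe, coe_nnnorm]
    exact this


/-! ### Lipschitz bounds: gluing, and the mean value theorem form -/

/-- Gluing Lipschitz bounds with the same constant on `[a, m]` and `[m, b]`. [folklore] -/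
theorem lipschitzOnWith_Icc_of_split {φ : ℝ → ℝ} {K : NNReal} {a m b : ℝ}
    (h1 : LipschitzOnWith K φ (Set.Icc a m)) (h2 : LipschitzOnWith K φ (Set.Icc m b)) :
    LipschitzOnWith K φ (Set.Icc a b) := by
  have key : ∀ x ∈ Set.Icc a b, ∀ y ∈ Set.Icc a b, x ≤ m → m ≤ y →
      dist (φ x) (φ y) ≤ K * dist x y := by
    intro x hx y hy hxm hmy
    have hm1 : m ∈ Set.Icc a m := ⟨hx.1.trans hxm, le_rfl⟩
    have hm2 : m ∈ Set.Icc m b := ⟨le_rfl, hmy.trans hy.2⟩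
    calc dist (φ x) (φ y) ≤ dist (φ x) (φ m) + dist (φ m) (φ y) := dist_triangle _ _ _
      _ ≤ K * dist x m + K * dist m y :=
          add_le_add (h1.dist_le_mul x ⟨hx.1, hxm⟩ m hm1) (h2.dist_le_mul m hm2 y ⟨hmy, hy.2⟩)
      _ = K * dist x y := by
          rw [Real.dist_eq, Real.dist_eq, Real.dist_eq, abs_of_nonpos (by linarith),
            abs_of_nonpos (by linarith), abs_of_nonpos (by linarith)]
          ring
  refine LipschitzOnWith.of_dist_le_mul fun x hx y hy => ?_
  rcases le_total x m with hxm | hxm <;> rcases le_total y m with hym | hym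
  · exact h1.dist_le_mul x ⟨hx.1, hxm⟩ y ⟨hy.1, hym⟩
  · exact key x hx y hy hxm hym
  · rw [dist_comm, dist_comm x]; exact key y hy x hx hym hxm
  · exact h2.dist_le_mul x ⟨hxm, hx.2⟩ y ⟨hym, hy.2⟩

/-- **Lipschitz from the mean value theorem**: `g` continuous on `[a, b]` with `|g'| ≤ C` on
`(a, b)` is `C`-Lipschitz on `[a, b]`. [folklore] -/
theorem lipschitzOnWith_of_hasDerivAt_Ioo {g g' : ℝ → ℝ} {a b C : ℝ} (hC : 0 ≤ C)
    (hcont : ContinuousOn g (Set.Icc a b)) (hderiv : ∀ x ∈ Set.Ioo a b, HasDerivAt g (g' x) x)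
    (hbound : ∀ x ∈ Set.Ioo a b, |g' x| ≤ C) :
    LipschitzOnWith ⟨C, hC⟩ g (Set.Icc a b) := by
  have key : ∀ x ∈ Set.Icc a b, ∀ y ∈ Set.Icc a b, x < y → |g y - g x| ≤ C * (y - x) := by
    intro x hx y hy hxy
    obtain ⟨ξ, hξ, hslope⟩ := exists_hasDerivAt_eq_slope g g' hxy
      (hcont.mono (Set.Icc_subset_Icc hx.1 hy.2))
      (fun t ht => hderiv t ⟨lt_of_le_of_lt hx.1 ht.1, lt_of_lt_of_le ht.2 hy.2⟩)
    have hξ' : ξ ∈ Set.Ioo a b := ⟨lt_of_le_of_lt hx.1 hξ.1, lt_of_lt_of_le hξ.2 hy.2⟩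
    have hb := hbound ξ hξ'
    rw [hslope, abs_div, abs_of_pos (by linarith : 0 < y - x), div_le_iff₀ (by linarith)] at hb
    exact hb
  refine LipschitzOnWith.of_dist_le_mul fun x hx y hy => ?_
  rw [Real.dist_eq, Real.dist_eq]
  change |g x - g y| ≤ C * |x - y|
  rcases lt_trichotomy x y with hxy | rfl | hxy
  · rw [abs_sub_comm, abs_of_neg (by linarith : x - y < 0), neg_sub]; exact key x hx y hy hxy
  · simp
  · rw [abs_of_pos (by linarith : 0 < x - y)]; exact key y hy x hx hxy

/-! ### `F`, `f` and `s F(s)` are bounded and Lipschitz on compact subintervals of `(0, ∞)` -/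

namespace IsLinearSieveFunctions

variable {F f : ℝ → ℝ}

/-- `F` is bounded on `[a, b]`, `a > 0`. [folklore] -/
theorem exists_bound_upper (h : IsLinearSieveFunctions F f) {a b : ℝ} (ha : 0 < a) :
    ∃ C, ∀ s ∈ Set.Icc a b, |F s| ≤ C := by
  obtain ⟨C, hC⟩ := isCompact_Icc.exists_bound_of_continuousOn
    (h.continuousOn_upper.mono fun t (ht : t ∈ Set.Icc a b) => lt_of_lt_of_le ha ht.1)
  exact ⟨C, fun s hs => by simpa [Real.norm_eq_abs] using hC s hs⟩

/-- `f` is bounded on `[a, b]`, `a > 0`. [folklore] -/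
theorem exists_bound_lower (h : IsLinearSieveFunctions F f) {a b : ℝ} (ha : 0 < a) :
    ∃ C, ∀ s ∈ Set.Icc a b, |f s| ≤ C := by
  obtain ⟨C, hC⟩ := isCompact_Icc.exists_bound_of_continuousOn
    (h.continuousOn_lower.mono fun t (ht : t ∈ Set.Icc a b) => lt_of_lt_of_le ha ht.1)
  exact ⟨C, fun s hs => by simpa [Real.norm_eq_abs] using hC s hs⟩

/-- **`s ↦ s F(s)` is Lipschitz on `[a, b]`, `a > 0`** (it is `C¹` on `(0, ∞)`,
`hasDerivAt_mul_upper`). [folklore] -/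
theorem exists_lipschitzOnWith_mul_upper (h : IsLinearSieveFunctions F f) {a b : ℝ}
    (ha : 0 < a) : ∃ K, LipschitzOnWith K (fun s : ℝ => s * F s) (Set.Icc a b) := by
  have hcont : ContinuousOn (mulUpperDeriv f) (Set.Icc a b) :=
    h.continuousOn_mulUpperDeriv.mono fun t ht => lt_of_lt_of_le ha ht.1
  obtain ⟨C, hC⟩ := isCompact_Icc.exists_bound_of_continuousOn hcont
  set C' := max C 0 with hC'
  refine ⟨⟨C', le_max_right _ _⟩, ?_⟩
  refine (convex_Icc a b).lipschitzOnWith_of_nnnorm_hasDerivWithin_le (f := fun s : ℝ => s * F s)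
    (f' := mulUpperDeriv f) (fun t ht => ?_) (fun t ht => ?_)
  · exact (h.hasDerivAt_mul_upper (lt_of_lt_of_le ha ht.1)).hasDerivWithinAt
  · have := (hC t ht).trans (le_max_left C 0)
    rw [← NNReal.coe_le_coe, coe_nnnorm]
    exact this

/-- **`f` is Lipschitz on `[a, b]`, `a > 0`.**  On `(0, 2]` `f = 0`; on `[2, b]` the function
`t f(t)` is continuous with derivative `F(t − 1)` on `(2, b)` (mean value theorem), and
`f(t) = (t f(t))/t`; the two pieces are glued at `t = 2` (where `f` has a corner). [folklore] -/
theorem exists_lipschitzOnWith_lower (h : IsLinearSieveFunctions F f) {a b : ℝ} (ha : 0 < a) :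
    ∃ K, LipschitzOnWith K f (Set.Icc a b) := by
  -- enlarge the interval so that `[1, b']`, `[2, b']` are nonempty
  set b' := max b 3 with hb'
  have hb3 : (3 : ℝ) ≤ b' := le_max_right _ _
  suffices H : ∃ K, LipschitzOnWith K f (Set.Icc a b') by
    obtain ⟨K, hK⟩ := H
    exact ⟨K, hK.mono (Set.Icc_subset_Icc le_rfl (le_max_left _ _))⟩
  -- constants: `|F| ≤ CF` on `[1, b']`, `|t f(t)| ≤ CG` on `[2, b']`
  obtain ⟨CF, hCF⟩ := h.exists_bound_upper (a := 1) (b := b') one_pos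
  have hCF0 : 0 ≤ CF := (abs_nonneg _).trans (hCF 1 ⟨le_rfl, by linarith⟩)
  set g : ℝ → ℝ := fun t => t * f t with hg
  have hgcont : ContinuousOn g (Set.Icc 2 b') := h.continuousOn_mul_lower (by norm_num)
  obtain ⟨CG, hCG⟩ := isCompact_Icc.exists_bound_of_continuousOn hgcont
  have hCG' : ∀ t ∈ Set.Icc (2 : ℝ) b', |g t| ≤ CG := fun t ht => by
    simpa [Real.norm_eq_abs] using hCG t ht
  have hCG0 : 0 ≤ CG := (abs_nonneg _).trans (hCG' 2 ⟨le_rfl, by linarith⟩)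
  -- Step A: `g` is `CF`-Lipschitz on `[2, b']` (mean value theorem)
  have hA : LipschitzOnWith ⟨CF, hCF0⟩ g (Set.Icc 2 b') := by
    refine lipschitzOnWith_of_hasDerivAt_Ioo hCF0 hgcont (g' := fun t => F (t - 1))
      (fun t ht => h.hasDerivAt_lower t ht.1) (fun t ht => hCF (t - 1) ⟨by linarith [ht.1], ?_⟩)
    linarith [ht.2]
  -- Step B: `f = g / id` is Lipschitz on `[2, b']`
  set K₂ : ℝ := CF / 2 + CG / 4 with hK₂
  have hK₂0 : 0 ≤ K₂ := by positivity
  have hB : LipschitzOnWith ⟨K₂, hK₂0⟩ f (Set.Icc 2 b') := by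
    refine LipschitzOnWith.of_dist_le_mul fun x hx y hy => ?_
    have hx2 : (2 : ℝ) ≤ x := hx.1
    have hy2 : (2 : ℝ) ≤ y := hy.1
    have hx0 : x ≠ 0 := by linarith
    have hy0 : y ≠ 0 := by linarith
    have hfx : f x = g x / x := by simp only [hg]; field_simp
    have hfy : f y = g y / y := by simp only [hg]; field_simp
    have hgxy : |g x - g y| ≤ CF * |x - y| := by
      have := hA.dist_le_mul x hx y hy
      rwa [Real.dist_eq, Real.dist_eq] at this
    rw [Real.dist_eq, Real.dist_eq]
    change |f x - f y| ≤ K₂ * |x - y|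
    rw [hfx, hfy]
    have e : g x / x - g y / y = (g x - g y) / x + g y * (y - x) / (x * y) := by
      field_simp; ring
    rw [e]
    have h1 : |(g x - g y) / x| ≤ CF * |x - y| / 2 := by
      rw [abs_div, abs_of_pos (by linarith : (0 : ℝ) < x), div_le_div_iff₀ (by linarith) two_pos]
      have h0 : 0 ≤ CF * |x - y| := mul_nonneg hCF0 (abs_nonneg _)
      calc |g x - g y| * 2 ≤ CF * |x - y| * 2 := by gcongr
        _ ≤ CF * |x - y| * x := by gcongr
    have h2 : |g y * (y - x) / (x * y)| ≤ CG * |x - y| / 4 := by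
      rw [abs_div, abs_mul, abs_of_pos (by positivity : (0 : ℝ) < x * y), abs_sub_comm y x,
        div_le_div_iff₀ (by positivity) (by norm_num)]
      have := hCG' y hy
      have hxy4 : (4 : ℝ) ≤ x * y := by nlinarith
      calc |g y| * |x - y| * 4 ≤ CG * |x - y| * 4 := by gcongr
        _ ≤ CG * |x - y| * (x * y) := by gcongr
    calc |(g x - g y) / x + g y * (y - x) / (x * y)|
        ≤ |(g x - g y) / x| + |g y * (y - x) / (x * y)| := abs_add_le _ _
      _ ≤ CF * |x - y| / 2 + CG * |x - y| / 4 := add_le_add h1 h2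
      _ = K₂ * |x - y| := by rw [hK₂]; ring
  -- Step C: `f = 0` on `[a, 2]`
  have hC : LipschitzOnWith ⟨K₂, hK₂0⟩ f (Set.Icc a 2) := by
    refine LipschitzOnWith.of_dist_le_mul fun x hx y hy => ?_
    rw [h.lower_eq_zero (lt_of_lt_of_le ha hx.1) hx.2, h.lower_eq_zero (lt_of_lt_of_le ha hy.1) hy.2,
      dist_self]
    positivity
  exact ⟨_, lipschitzOnWith_Icc_of_split hC hB⟩

end IsLinearSieveFunctions


/-! ### `V(u) > 0`, the limit `Λ₀ = lim V(t) log t > 0`, and uniform closeness beyond `x^a` -/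

/-- `V(u) = ∏_{p < u} (1 − ρ(p)/p) > 0`. [folklore] -/
theorem densityProd_pos (u : ℝ) : 0 < densityProd u := by
  unfold densityProd
  refine Finset.prod_pos fun p hp => ?_
  have hpp : p.Prime := (Nat.mem_primesBelow.mp hp).2
  have h := rhoArith_lt_prime hpp
  rw [rhoArith_apply] at h
  have hp0 : (0 : ℝ) < p := by exact_mod_cast hpp.pos
  rw [sub_pos, div_lt_one hp0]
  exact h

/-- `Λ₀ = 2Γ e^{−γ}`, the limit of `V(t) log t` (`tendsto_densityProd_mul_log`). [folklore] -/
def lambda0 : ℝ := hardyLittlewoodEConst * Real.exp (-Real.eulerMascheroniConstant)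

/-- `Λ₀ > 0`. [folklore] -/
theorem lambda0_pos : 0 < lambda0 := by
  unfold lambda0
  have : 0 < hardyLittlewoodEConst := by
    have h := gamma_pos
    unfold gamma at h
    linarith
  positivity

/-- **Uniform closeness**: for `δ > 0`, `a > 0` and all large `x`, `|V(t) log t − Λ₀| ≤ δ` for every
`t ≥ x^a` (p. 186: "`V(Z) = V(z)(log z/log z_q)(1 + O(1/log z))`", here in the qualitative form that
§6 needs). [cite: IwaniecInventiones1978, §5 p. 186] -/
theorem eventually_forall_abs_densityProd_mul_log_sub_le {δ a : ℝ} (hδ : 0 < δ) (ha : 0 < a) :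
    ∀ᶠ x : ℝ in atTop, ∀ t : ℝ, x ^ a ≤ t → |densityProd t * Real.log t - lambda0| ≤ δ := by
  have h := tendsto_densityProd_mul_log
  have h1 : ∀ᶠ t : ℝ in atTop, |densityProd t * Real.log t - lambda0| ≤ δ := by
    have := (Metric.tendsto_nhds.mp h) δ hδ
    filter_upwards [this] with t ht
    rw [Real.dist_eq] at ht
    exact ht.le
  obtain ⟨T, hT⟩ := eventually_atTop.mp h1
  filter_upwards [(tendsto_rpow_atTop ha).eventually_ge_atTop T] with x hx t ht
  exact hT t (hx.trans ht)

/-- The two-sided form: for large `x` and `t ≥ x^a`, `Λ₀/2 ≤ V(t) log t ≤ 2Λ₀`. [folklore] -/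
theorem eventually_forall_densityProd_mul_log_mem {a : ℝ} (ha : 0 < a) :
    ∀ᶠ x : ℝ in atTop, ∀ t : ℝ, x ^ a ≤ t →
      lambda0 / 2 ≤ densityProd t * Real.log t ∧ densityProd t * Real.log t ≤ 2 * lambda0 := by
  filter_upwards [eventually_forall_abs_densityProd_mul_log_sub_le (half_pos lambda0_pos) ha]
    with x hx t ht
  have h := hx t ht
  rw [abs_le] at h
  constructor <;> linarith [h.1, h.2, lambda0_pos]

/-! ### `ρ(q) = 0` forces `S(𝒜_q, u) = 0` -/

/-- If `ρ(q) = 0` then no `n² + 1` is divisible by `q`. [folklore] -/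
theorem not_dvd_of_rho_eq_zero {q : ℕ} (hq : rho q = 0) (n : ℕ) : ¬ q ∣ n ^ 2 + 1 := by
  intro hdvd
  rcases Nat.eq_zero_or_pos q with rfl | hq0
  · simp at hdvd
  have hmem : n % q ∈ (Finset.range q).filter fun ν : ℕ => q ∣ ν ^ 2 + 1 := by
    rw [Finset.mem_filter, Finset.mem_range]
    refine ⟨Nat.mod_lt n hq0, ?_⟩
    have hmod : (n % q) ^ 2 + 1 ≡ n ^ 2 + 1 [MOD q] :=
      Nat.ModEq.add_right 1 ((Nat.mod_modEq n q).pow 2)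
    exact (Nat.modEq_zero_iff_dvd.mp (hmod.trans (Nat.modEq_zero_iff_dvd.mpr hdvd)))
  unfold rho at hq
  rw [Finset.card_eq_zero] at hq
  rw [hq] at hmem
  exact absurd hmem (Finset.notMem_empty _)

/-- `ρ(q) = 0 ⟹ S(𝒜_q, u) = 0`. [folklore] -/
theorem siftedCount_eq_zero_of_rho_eq_zero (x : ℝ) {q : ℕ} (hq : rho q = 0) (u : ℝ) :
    siftedCount x q u = 0 := by
  unfold siftedCount
  rw [Finset.card_eq_zero, Finset.filter_eq_empty_iff]
  intro n _ h
  exact not_dvd_of_rho_eq_zero hq n h.1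


/-! ### Sums of `ρ(q)/q` over `x^γ`-rough `q < x` are `O_γ(1)` -/

/-- `g(d) = ρ(d)/d` as a real arithmetic function. [folklore] -/
def rhoDivArith : ArithmeticFunction ℝ := ⟨fun n => (rho n : ℝ) / n, by simp [rho_zero]⟩

/-- `rhoDivArith n = ρ(n)/n`. [folklore] -/
@[simp] theorem rhoDivArith_apply (n : ℕ) : rhoDivArith n = (rho n : ℝ) / n := rfl

/-- `ρ(d)/d` is multiplicative. [folklore] -/
theorem isMultiplicative_rhoDivArith : ArithmeticFunction.IsMultiplicative rhoDivArith := by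
  refine ⟨by simp [rho_one], fun {m n} h => ?_⟩
  have hm := isMultiplicative_rhoArith.map_mul_of_coprime h
  simp only [rhoArith_apply] at hm
  simp only [rhoDivArith_apply, hm, Nat.cast_mul]
  rw [div_mul_div_comm]

/-- `∑_{a ≤ A} ρ(p^a)/p^a ≤ 1 + ρ(p)/p + 4/p²` for a prime `p`. [folklore] -/
theorem sum_range_rhoDivArith_primePow_le {p : ℕ} (hp : p.Prime) (A : ℕ) :
    ∑ a ∈ Finset.range (A + 1), rhoDivArith (p ^ a) ≤ 1 + (rho p : ℝ) / p + 4 / (p : ℝ) ^ 2 := by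
  have hsplit : Finset.range (A + 1) = {0, 1} ∪ Finset.Icc 2 A ∨ A = 0 := by
    rcases Nat.eq_zero_or_pos A with h | h
    · exact Or.inr h
    · left; ext a; simp only [Finset.mem_range, Finset.mem_union, Finset.mem_insert,
        Finset.mem_singleton, Finset.mem_Icc]; omega
  have hp0 : (0 : ℝ) < p := by exact_mod_cast hp.pos
  have h4 : 0 ≤ 4 / (p : ℝ) ^ 2 := by positivity
  have hρ : 0 ≤ (rho p : ℝ) / p := by positivity
  rcases hsplit with hsplit | hA
  · rw [hsplit, Finset.sum_union]
    · have h01 : ∑ a ∈ ({0, 1} : Finset ℕ), rhoDivArith (p ^ a) = 1 + (rho p : ℝ) / p := by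
        rw [Finset.sum_pair (by norm_num)]
        simp [rho_one]
      rw [h01]
      have htail := sum_rho_primePow_div_le hp A
      have heq : ∑ a ∈ Finset.Icc 2 A, rhoDivArith (p ^ a) =
          ∑ a ∈ Finset.Icc 2 A, rhoArith (p ^ a) / (p : ℝ) ^ a := by
        refine Finset.sum_congr rfl fun a _ => ?_
        simp [rhoDivArith_apply, rhoArith_apply]
      rw [heq]
      linarith
    · rw [Finset.disjoint_left]
      intro a ha
      simp only [Finset.mem_insert, Finset.mem_singleton] at ha
      simp only [Finset.mem_Icc]; omega
  · subst hA
    simp [rho_one]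
    linarith

/-- `∑_{w ≤ p < z} 4/p² ≤ 8/w` for `w ≥ 2`. [folklore] -/
theorem sum_four_div_sq_le {w z : ℝ} (hw : 2 ≤ w) :
    ∑ p ∈ (Nat.primesBelow ⌈z⌉₊).filter (fun p : ℕ => w ≤ (p : ℝ)), 4 / (p : ℝ) ^ 2 ≤ 8 / w := by
  set k : ℕ := ⌈w⌉₊ - 1 with hk
  have hceil : 1 ≤ ⌈w⌉₊ := Nat.one_le_iff_ne_zero.mpr (Nat.ceil_pos.mpr (by linarith)).ne'
  set S := (Nat.primesBelow ⌈z⌉₊).filter (fun p : ℕ => w ≤ (p : ℝ)) with hS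
  have hsub : S ⊆ Finset.Ioo k ⌈z⌉₊ := by
    intro p hp
    simp only [hS, Finset.mem_filter, Nat.mem_primesBelow, Finset.mem_Ioo] at hp ⊢
    obtain ⟨⟨hpz, _⟩, hwp⟩ := hp
    refine ⟨?_, hpz⟩
    have : ⌈w⌉₊ ≤ p := Nat.ceil_le.mpr hwp
    omega
  calc ∑ p ∈ S, 4 / (p : ℝ) ^ 2 = 4 * ∑ p ∈ S, ((p : ℝ) ^ 2)⁻¹ := by
        rw [Finset.mul_sum]; exact Finset.sum_congr rfl fun p _ => by rw [div_eq_mul_inv]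
    _ ≤ 4 * ∑ i ∈ Finset.Ioo k ⌈z⌉₊, ((i : ℝ) ^ 2)⁻¹ :=
        mul_le_mul_of_nonneg_left
          (Finset.sum_le_sum_of_subset_of_nonneg hsub fun i _ _ => by positivity) (by norm_num)
    _ ≤ 4 * (2 / (k + 1)) := mul_le_mul_of_nonneg_left (sum_Ioo_inv_sq_le k ⌈z⌉₊) (by norm_num)
    _ = 8 / (⌈w⌉₊ : ℝ) := by rw [hk, Nat.cast_sub hceil]; push_cast; ring
    _ ≤ 8 / w := div_le_div_of_nonneg_left (by norm_num) (by linarith) (Nat.le_ceil w)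

/-- **The sum of `ρ(q)/q` over the `x^γ`-rough integers `q < x` is `O_γ(1)`**: given the tail form
of Mertens II for `ρ` (`hM2`, proved in `IwaniecAlmostPrimesMertens.lean`), for all large `x` and
every finite set `T` of integers `1 ≤ q < x` coprime to `P(x^γ)`, `∑_{q ∈ T} ρ(q)/q ≤ e²/γ`
(each such `q` divides `∏_{x^γ ≤ p < x} p^A`, and `∑_{d ∣ N} ρ(d)/d = ∏ ∑_a ρ(p^a)/p^a ≤
exp ∑ (ρ(p)/p + 4/p²)`).  This bounds the factor `∑ c_q ρ(q)/q` implicit in the `O_γ(ε)` of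
Proposition 2. [cite: IwaniecInventiones1978, §5 p. 186] -/
theorem eventually_sum_rough_rho_div_le {γ : ℝ} (hγ : 0 < γ) (hγ1 : γ < 1)
    (hM2 : ∃ C₂ : ℝ, ∀ w z : ℝ, 2 ≤ w → w < z →
      ∑ p ∈ (Nat.primesBelow ⌈z⌉₊).filter (fun p : ℕ => w ≤ (p : ℝ)), (rho p : ℝ) / p ≤
        Real.log (Real.log z / Real.log w) + C₂ / Real.log w) :
    ∀ᶠ x : ℝ in atTop, ∀ T : Finset ℕ,
      (∀ q ∈ T, 1 ≤ q ∧ (q : ℝ) < x ∧ q.Coprime (primesProdBelow (x ^ γ))) →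
        ∑ q ∈ T, (rho q : ℝ) / q ≤ Real.exp 2 / γ := by
  obtain ⟨C₂, hC₂⟩ := hM2
  -- largeness conditions: `x^γ ≥ 2`, `x^γ < x`, `C₂/(γ log x) ≤ 1`, `8/x^γ ≤ 1`
  have hev1 : ∀ᶠ x : ℝ in atTop, 2 ≤ x ^ γ := (tendsto_rpow_atTop hγ).eventually_ge_atTop 2
  have hev2 : ∀ᶠ x : ℝ in atTop, C₂ / (γ * Real.log x) ≤ 1 := by
    have : Tendsto (fun x : ℝ => C₂ / (γ * Real.log x)) atTop (𝓝 0) :=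
      tendsto_const_nhds.div_atTop (Real.tendsto_log_atTop.const_mul_atTop hγ)
    exact (this.eventually (ge_mem_nhds one_pos)).mono fun x hx => hx
  have hev3 : ∀ᶠ x : ℝ in atTop, 8 / x ^ γ ≤ 1 := by
    have : Tendsto (fun x : ℝ => 8 / x ^ γ) atTop (𝓝 0) :=
      tendsto_const_nhds.div_atTop (tendsto_rpow_atTop hγ)
    exact (this.eventually (ge_mem_nhds one_pos)).mono fun x hx => hx
  filter_upwards [hev1, hev2, hev3, eventually_gt_atTop (1 : ℝ)] with x hx1 hx2 hx3 hx T hT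
  have hx0 : 0 < x := by linarith
  have hxγ : x ^ γ < x := by
    conv_rhs => rw [← Real.rpow_one x]
    exact Real.rpow_lt_rpow_of_exponent_lt hx hγ1
  -- the primes `x^γ ≤ p < x` and the modulus `Nbig`
  set S := (Nat.primesBelow ⌈x⌉₊).filter (fun p : ℕ => x ^ γ ≤ (p : ℝ)) with hS
  set A : ℕ := ⌈x⌉₊ with hA
  set Nbig : ℕ := ∏ p ∈ S, p ^ A with hNbig
  have hSprime : ∀ p ∈ S, p.Prime := fun p hp => (Nat.mem_primesBelow.mp (Finset.mem_filter.mp hp).1).2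
  have hNbig0 : Nbig ≠ 0 := Finset.prod_ne_zero_iff.mpr fun p hp => pow_ne_zero _ (hSprime p hp).ne_zero
  -- every `q ∈ T` divides `Nbig`
  have hdvd : ∀ q ∈ T, q ∣ Nbig := by
    intro q hq
    obtain ⟨hq1, hqx, hcop⟩ := hT q hq
    have hq0 : q ≠ 0 := by omega
    have hPF : q.primeFactors ⊆ S := by
      intro p hp
      have hpp := Nat.prime_of_mem_primeFactors hp
      have hpq : p ∣ q := Nat.dvd_of_mem_primeFactors hp
      rw [hS, Finset.mem_filter, Nat.mem_primesBelow]
      refine ⟨⟨?_, hpp⟩, ?_⟩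
      · have : (p : ℝ) < x := lt_of_le_of_lt (by exact_mod_cast Nat.le_of_dvd (by omega) hpq) hqx
        exact Nat.lt_ceil.mpr this
      · by_contra hlt
        push Not at hlt
        have hpP : p ∣ primesProdBelow (x ^ γ) := by
          unfold primesProdBelow
          exact Finset.dvd_prod_of_mem _ (Nat.mem_primesBelow.mpr ⟨Nat.lt_ceil.mpr hlt, hpp⟩)
        have h1 : p ∣ Nat.gcd q (primesProdBelow (x ^ γ)) := Nat.dvd_gcd hpq hpP
        rw [hcop] at h1
        exact hpp.not_dvd_one h1
    rw [Nat.prod_primeFactors_pow_factorization hq0]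
    calc ∏ p ∈ q.primeFactors, p ^ q.factorization p ∣ ∏ p ∈ q.primeFactors, p ^ A := by
          refine Finset.prod_dvd_prod_of_dvd _ _ fun p hp => pow_dvd_pow p ?_
          -- `v_p(q) ≤ p^{v_p(q)} ≤ q ≤ ⌈x⌉ = A`
          have hpp := Nat.prime_of_mem_primeFactors hp
          have h1 : p ^ q.factorization p ≤ q := Nat.le_of_dvd (by omega) (Nat.ordProj_dvd q p)
          have h2 : q.factorization p < p ^ q.factorization p := Nat.lt_pow_self hpp.one_lt
          have h3 : q ≤ A := by
            rw [hA]; exact_mod_cast (hqx.le.trans (Nat.le_ceil x))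
          omega
      _ ∣ Nbig := Finset.prod_dvd_prod_of_subset _ _ _ hPF
  -- `T ⊆ divisors Nbig`
  have hTsub : T ⊆ Nbig.divisors := fun q hq => Nat.mem_divisors.mpr ⟨hdvd q hq, hNbig0⟩
  have hstep1 : ∑ q ∈ T, (rho q : ℝ) / q ≤ ∑ d ∈ Nbig.divisors, rhoDivArith d := by
    calc ∑ q ∈ T, (rho q : ℝ) / q = ∑ q ∈ T, rhoDivArith q := by simp
      _ ≤ ∑ d ∈ Nbig.divisors, rhoDivArith d :=
          Finset.sum_le_sum_of_subset_of_nonneg hTsub fun d _ _ => by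
            rw [rhoDivArith_apply]; positivity
  -- multiplicativity: `∑_{d ∣ Nbig} g(d) = ∏_{p ∈ S} ∑_{a ≤ A} g(p^a)`
  have hmult : (rhoDivArith * (ArithmeticFunction.zeta : ArithmeticFunction ℝ)).IsMultiplicative :=
    isMultiplicative_rhoDivArith.mul ArithmeticFunction.isMultiplicative_zeta.natCast
  have hstep2 : ∑ d ∈ Nbig.divisors, rhoDivArith d =
      ∏ p ∈ S, ∑ a ∈ Finset.range (A + 1), rhoDivArith (p ^ a) := by
    rw [← ArithmeticFunction.coe_mul_zeta_apply, hNbig]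
    rw [hmult.map_prod (fun p : ℕ => p ^ A) S ?_]
    · refine Finset.prod_congr rfl fun p hp => ?_
      rw [ArithmeticFunction.coe_mul_zeta_apply, Nat.sum_divisors_prime_pow (hSprime p hp)]
    · intro p hp p' hp' hne
      exact (Nat.coprime_pow_primes _ _ (hSprime p hp) (hSprime p' hp') hne)
  -- each factor `≤ 1 + ρ(p)/p + 4/p² ≤ exp(ρ(p)/p + 4/p²)`
  have hstep3 : ∏ p ∈ S, ∑ a ∈ Finset.range (A + 1), rhoDivArith (p ^ a) ≤
      Real.exp (∑ p ∈ S, ((rho p : ℝ) / p + 4 / (p : ℝ) ^ 2)) := by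
    rw [Real.exp_sum]
    refine Finset.prod_le_prod (fun p _ => Finset.sum_nonneg fun a _ => by
      rw [rhoDivArith_apply]; positivity) fun p hp => ?_
    refine (sum_range_rhoDivArith_primePow_le (hSprime p hp) A).trans ?_
    have := Real.add_one_le_exp ((rho p : ℝ) / p + 4 / (p : ℝ) ^ 2)
    linarith
  -- the exponent is at most `log(1/γ) + 2`
  have hlogx : 0 < Real.log x := Real.log_pos hx
  have hstep4 : ∑ p ∈ S, ((rho p : ℝ) / p + 4 / (p : ℝ) ^ 2) ≤ Real.log (1 / γ) + 2 := by
    rw [Finset.sum_add_distrib]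
    have hA' := hC₂ (x ^ γ) x hx1 hxγ
    have hB' := sum_four_div_sq_le (z := x) hx1
    have hlogxγ : Real.log (x ^ γ) = γ * Real.log x := Real.log_rpow hx0 γ
    rw [hlogxγ] at hA'
    have h1 : Real.log (Real.log x / (γ * Real.log x)) = Real.log (1 / γ) := by
      congr 1; field_simp
    rw [h1] at hA'
    linarith
  calc ∑ q ∈ T, (rho q : ℝ) / q ≤ ∑ d ∈ Nbig.divisors, rhoDivArith d := hstep1
    _ = ∏ p ∈ S, ∑ a ∈ Finset.range (A + 1), rhoDivArith (p ^ a) := hstep2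
    _ ≤ Real.exp (∑ p ∈ S, ((rho p : ℝ) / p + 4 / (p : ℝ) ^ 2)) := hstep3
    _ ≤ Real.exp (Real.log (1 / γ) + 2) := Real.exp_le_exp.mpr hstep4
    _ = Real.exp 2 / γ := by
        rw [Real.exp_add, Real.exp_log (by positivity)]; ring


/-! ### Lemma 2 applied to `ℬ = 𝒜_q` with `X = ρ(q) x / q`, `ω = ρ` -/

/-- **Lemma 2 for `ℬ = 𝒜_q`** (p. 185: "for each `q` from `H(Q, Z)` we apply Lemma 2 to the
sequence `ℬ = 𝒜_q` with the parameter `X = ρ(q) x/q` as to have `r(ℬ, d) = r(𝒜_q, d) = r(𝒜, qd)`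
for all `d ∣ P(Z)`"): given `lemma2_bilinearSieve` and condition (1) for `ρ` (`hK`, proved in
`IwaniecAlmostPrimesMertens.lean`), for `q ≥ 1` with `ρ(q) > 0`, `2 ≤ u ≤ (MN)^{1/2}` and
`(q, P(u)) = 1`:
`S(𝒜_q, u) ≤ V(u) X {F(s) + E} + R⁺`, `S(𝒜_q, u) ≥ V(u) X {f(s) − E} − R⁻` with
`s = log MN / log u`, `E = c₀(ε + ε⁻⁸ e^{K+9} (log MN)^{−1/3})` and
`R^± = ∑_{l<L} ∑_{m<M} ∑_{n<N, mn ∣ P(u)} a^±_{l,m} b^±_{l,n} r(𝒜; qmn)`, the coefficients depending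
on `M, N, ε` (and `F, f`) only. [cite: IwaniecInventiones1978, §5 p. 185, (21)] -/
theorem lemma2_multisetAq (h2 : lemma2_bilinearSieve)
    (hK : ∃ K : ℝ, 1 ≤ K ∧ ∀ w z : ℝ, 2 ≤ w → w < z →
      ∏ p ∈ (Nat.primesBelow ⌈z⌉₊).filter (fun p : ℕ => w ≤ (p : ℝ)), (1 - (rho p : ℝ) / p)⁻¹ ≤
        Real.log z / Real.log w * (1 + K / Real.log w)) :
    ∃ c₀ K : ℝ, 0 < c₀ ∧ 1 ≤ K ∧
    ∀ (F f : ℝ → ℝ), IsLinearSieveFunctions F f →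
    ∀ (ε M N : ℝ), 0 < ε → ε < 1 / 3 → 1 < M → 1 < N →
      ∃ (L : ℕ) (au bu al bl : ℕ → ℕ → ℝ),
        (L : ℝ) ≤ Real.exp (8 * ε⁻¹ ^ 3) ∧
        (∀ l m, |au l m| ≤ 1) ∧ (∀ l n, |bu l n| ≤ 1) ∧ (∀ l m, |al l m| ≤ 1) ∧
        (∀ l n, |bl l n| ≤ 1) ∧
        ∀ (x : ℝ) (q : ℕ), 0 < x → 0 < q → 0 < rho q →
          ∀ u : ℝ, 2 ≤ u → u ≤ (M * N) ^ (1 / 2 : ℝ) → q.Coprime (primesProdBelow u) →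
            let X : ℝ := (rho q : ℝ) * x / q
            let s : ℝ := Real.log (M * N) / Real.log u
            let E : ℝ := c₀ * (ε + ε⁻¹ ^ 8 * Real.exp (K + 9) * Real.log (M * N) ^ (-(1 / 3 : ℝ)))
            let R : (ℕ → ℕ → ℝ) → (ℕ → ℕ → ℝ) → ℝ := fun a b =>
              ∑ l ∈ Finset.range L, ∑ m ∈ Finset.Ico 1 ⌈M⌉₊, ∑ n ∈ Finset.Ico 1 ⌈N⌉₊,
                if m * n ∣ primesProdBelow u then a l m * b l n * rem x (q * (m * n)) else 0
            (siftedCount x q u : ℝ) ≤ densityProd u * X * (F s + E) + R au bu ∧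
              densityProd u * X * (f s - E) - R al bl ≤ (siftedCount x q u : ℝ) := by
  obtain ⟨c₀, hc₀, H⟩ := h2
  obtain ⟨K, hK1, hKc⟩ := hK
  refine ⟨c₀, K, hc₀, hK1, fun F f hFf ε M N hε hε3 hM hN => ?_⟩
  obtain ⟨L, au, bu, al, bl, hL, hau, hbu, hal, hbl, H2⟩ := H F f hFf ε M N hε hε3 hM hN
  refine ⟨L, au, bu, al, bl, hL, hau, hbu, hal, hbl, fun x q hx hq hρ u hu2 huMN hcop => ?_⟩
  dsimp only
  have hρ' : (0 : ℝ) < rho q := by exact_mod_cast hρ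
  have hq' : (0 : ℝ) < q := by exact_mod_cast hq
  have hX : 0 < (rho q : ℝ) * x / q := by positivity
  have cond1 : ∀ w z : ℝ, 2 ≤ w → w < z →
      ∏ p ∈ (Nat.primesBelow ⌈z⌉₊).filter (fun p : ℕ => w ≤ (p : ℝ)), (1 - rhoArith p / p)⁻¹ ≤
        Real.log z / Real.log w * (1 + K / Real.log w) := fun w z hw hwz => hKc w z hw hwz
  have cond2 : ∀ w z : ℝ, 2 ≤ w → w < z → ∀ A : ℕ,
      ∑ p ∈ (Nat.primesBelow ⌈z⌉₊).filter (fun p : ℕ => w ≤ (p : ℝ)),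
        ∑ a ∈ Finset.Icc 2 A, rhoArith (p ^ a) / (p : ℝ) ^ a ≤ 9 / Real.log (3 * w) :=
    fun w z hw hwz A => rho_condition_two w z hw hwz A
  have H3 := H2 (multisetAq x q) ((rho q : ℝ) * x / q) rhoArith K 9 hX isMultiplicative_rhoArith
    rhoArith_nonneg (fun p hp => rhoArith_lt_prime hp) hK1 (by norm_num) cond1 cond2 u hu2 huMN
  dsimp only at H3
  rw [msifted_multisetAq] at H3
  -- identify the remainder terms
  have hr : ∀ m ∈ Finset.Ico 1 ⌈M⌉₊, ∀ n ∈ Finset.Ico 1 ⌈N⌉₊, m * n ∣ primesProdBelow u →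
      (mcount (multisetAq x q) (m * n) : ℝ) - rhoArith (m * n) / ((m * n : ℕ) : ℝ) *
        ((rho q : ℝ) * x / q) = rem x (q * (m * n)) := by
    intro m hm n hn hmn
    have hm0 : m ≠ 0 := by have := (Finset.mem_Ico.mp hm).1; omega
    have hn0 : n ≠ 0 := by have := (Finset.mem_Ico.mp hn).1; omega
    have hcop' : q.Coprime (m * n) := Nat.Coprime.coprime_dvd_right hmn hcop
    rw [rem_mul_eq_of_coprime x hq.ne' (mul_ne_zero hm0 hn0) hcop', rhoArith_apply]
  have hR : ∀ a b : ℕ → ℕ → ℝ,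
      (∑ l ∈ Finset.range L, ∑ m ∈ Finset.Ico 1 ⌈M⌉₊, ∑ n ∈ Finset.Ico 1 ⌈N⌉₊,
        if m * n ∣ primesProdBelow u then
          a l m * b l n * ((mcount (multisetAq x q) (m * n) : ℝ) -
            rhoArith (m * n) / ((m * n : ℕ) : ℝ) * ((rho q : ℝ) * x / q)) else 0) =
      ∑ l ∈ Finset.range L, ∑ m ∈ Finset.Ico 1 ⌈M⌉₊, ∑ n ∈ Finset.Ico 1 ⌈N⌉₊,
        if m * n ∣ primesProdBelow u then a l m * b l n * rem x (q * (m * n)) else 0 := by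
    intro a b
    refine Finset.sum_congr rfl fun l _ => Finset.sum_congr rfl fun m hm =>
      Finset.sum_congr rfl fun n hn => ?_
    split_ifs with hmn
    · rw [hr m hm n hn hmn]
    · rfl
  rw [hR au bu, hR al bl] at H3
  unfold densityProd
  simpa only [rhoArith_apply] using H3


/-! ### The remainder of a class: from Lemma 2's bilinear form to the Corollary of Proposition 1 -/

/-- For `m ∣ P` (`P` squarefree): `mn ∣ P ↔ n ∣ P ∧ (n, m) = 1`. [folklore] -/
theorem mul_dvd_squarefree_iff {P m n : ℕ} (hP : Squarefree P) (hm : m ∣ P) :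
    m * n ∣ P ↔ n ∣ P ∧ n.Coprime m := by
  constructor
  · intro h
    refine ⟨dvd_trans (dvd_mul_left n m) h, ?_⟩
    exact (Nat.coprime_of_squarefree_mul (hP.squarefree_of_dvd h)).symm
  · rintro ⟨hn, hcop⟩
    exact hcop.symm.mul_dvd_of_dvd_of_dvd hm hn

/-- **Rewriting one bilinear form of Lemma 2's remainder for `ℬ = 𝒜_q` through `B(x; qm, N)`**:
for `(q, P(u)) = 1` and coefficients `a, b`,
`∑_{m<M} ∑_{n<N} [mn ∣ P(u)] a_m b_n r(𝒜; qmn) = ∑_{m<M, m ∣ P(u)} a_m B(x; qm, N)` with the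
coefficients `b'_n = b_n [n ∣ P(u)]` inside `B` (p. 185, (21)). [cite: IwaniecInventiones1978, §5 (21)] -/
theorem remainder_eq_sum_bilinearB (x u M N : ℝ) {q : ℕ} (hq : q.Coprime (primesProdBelow u))
    (a b : ℕ → ℝ) :
    ∑ m ∈ Finset.Ico 1 ⌈M⌉₊, ∑ n ∈ Finset.Ico 1 ⌈N⌉₊,
        (if m * n ∣ primesProdBelow u then a m * b n * rem x (q * (m * n)) else 0) =
      ∑ m ∈ (Finset.Ico 1 ⌈M⌉₊).filter (fun m => m ∣ primesProdBelow u),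
        a m * bilinearB x (fun n => if n ∣ primesProdBelow u then b n else 0) (q * m) N := by
  rw [Finset.sum_filter]
  refine Finset.sum_congr rfl fun m _ => ?_
  by_cases hm : m ∣ primesProdBelow u
  · rw [if_pos hm, bilinearB, Finset.sum_filter, Finset.mul_sum]
    refine Finset.sum_congr rfl fun n _ => ?_
    have hiff0 := mul_dvd_squarefree_iff (n := n) (squarefree_primesProdBelow u) hm
    by_cases hn : n ∣ primesProdBelow u
    · have hnq : n.Coprime q := (Nat.Coprime.coprime_dvd_right hn hq).symm
      have hiff : n.Coprime m ↔ n.Coprime (q * m) :=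
        ⟨fun h => Nat.Coprime.mul_right hnq h, fun h => Nat.Coprime.coprime_mul_left_right h⟩
      by_cases hnm : n.Coprime m
      · rw [if_pos (hiff0.mpr ⟨hn, hnm⟩), if_pos (hiff.mp hnm), if_pos hn, mul_assoc q m n]; ring
      · rw [if_neg (fun h => hnm (hiff0.mp h).2), if_neg (fun h => hnm (hiff.mpr h)), mul_zero]
    · rw [if_neg (fun h => hn (hiff0.mp h).1)]
      split_ifs <;> simp
  · rw [if_neg hm]
    refine Finset.sum_eq_zero fun n _ => ?_
    rw [if_neg (fun h => hm (dvd_trans (dvd_mul_right m n) h))]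

/-- **The remainder of a class is admissible for the Corollary of Proposition 1** (p. 186: "the
latter error term being estimated by means of Corollary of Proposition 1"): for a finite set `T`
of moduli `q`, all coprime to `P(u)` and with `q M ≤ x^{1−4ε'}`, and coefficients bounded by `1`,
`|∑_{q ∈ T} c_q ∑_{m<M} ∑_{n<N} [mn ∣ P(u)] a_m b_n r(𝒜; qmn)| ≤ ∑_{m' < x^{1−4ε'}} |B(x; m', N)|`
with `b'_n = b_n [n ∣ P(u)]` (the pairs `(q, m)` inject into `m' = qm`, `mul_injOn_rough_smooth`).
[cite: IwaniecInventiones1978, §5 p. 186] -/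
theorem abs_remainder_class_le (x u M N D : ℝ) (T : Finset ℕ) (c a b : ℕ → ℝ)
    (hT : ∀ q ∈ T, 0 < q ∧ q.Coprime (primesProdBelow u) ∧ (q : ℝ) * M ≤ D)
    (hc : ∀ q, |c q| ≤ 1) (ha : ∀ m, |a m| ≤ 1) :
    |∑ q ∈ T, c q * ∑ m ∈ Finset.Ico 1 ⌈M⌉₊, ∑ n ∈ Finset.Ico 1 ⌈N⌉₊,
        (if m * n ∣ primesProdBelow u then a m * b n * rem x (q * (m * n)) else 0)| ≤
      ∑ m' ∈ Finset.Ico 1 ⌈D⌉₊,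
        |bilinearB x (fun n => if n ∣ primesProdBelow u then b n else 0) m' N| := by
  classical
  set b' : ℕ → ℝ := fun n => if n ∣ primesProdBelow u then b n else 0 with hb'
  set Mf := (Finset.Ico 1 ⌈M⌉₊).filter (fun m => m ∣ primesProdBelow u) with hMf
  set g : ℕ → ℝ := fun m' => |bilinearB x b' m' N| with hg
  -- rewrite through `B` and take absolute values inside
  have h1 : |∑ q ∈ T, c q * ∑ m ∈ Finset.Ico 1 ⌈M⌉₊, ∑ n ∈ Finset.Ico 1 ⌈N⌉₊,
      (if m * n ∣ primesProdBelow u then a m * b n * rem x (q * (m * n)) else 0)| ≤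
      ∑ q ∈ T, ∑ m ∈ Mf, g (q * m) := by
    refine (Finset.abs_sum_le_sum_abs _ _).trans (Finset.sum_le_sum fun q hq => ?_)
    rw [remainder_eq_sum_bilinearB x u M N (hT q hq).2.1 a b, abs_mul]
    refine (mul_le_of_le_one_left (abs_nonneg _) (hc q)).trans ?_
    refine (Finset.abs_sum_le_sum_abs _ _).trans (Finset.sum_le_sum fun m _ => ?_)
    rw [abs_mul]
    exact mul_le_of_le_one_left (abs_nonneg _) (ha m)
  refine h1.trans ?_
  -- the pairs `(q, m)` inject into `m' = q m < D`
  rw [← Finset.sum_product (s := T) (t := Mf) (f := fun qm : ℕ × ℕ => g (qm.1 * qm.2))]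
  have hinj : Set.InjOn (fun qm : ℕ × ℕ => qm.1 * qm.2) ↑(T ×ˢ Mf) := by
    refine (mul_injOn_rough_smooth u).mono fun qm hqm => ?_
    have h := Finset.mem_product.mp (Finset.mem_coe.mp hqm)
    exact ⟨(Finset.mem_filter.mp h.2).2, (hT qm.1 h.1).2.1⟩
  rw [← Finset.sum_image (g := fun qm : ℕ × ℕ => qm.1 * qm.2) (f := g) hinj]
  refine Finset.sum_le_sum_of_subset_of_nonneg (fun m' hm' => ?_) fun _ _ _ => abs_nonneg _
  obtain ⟨⟨q, m⟩, hqm, rfl⟩ := Finset.mem_image.mp hm'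
  obtain ⟨hq, hm⟩ := Finset.mem_product.mp hqm
  obtain ⟨hq0, -, hqM⟩ := hT q hq
  have hm1 : 1 ≤ m := (Finset.mem_Ico.mp (Finset.mem_filter.mp hm).1).1
  have hmM : m < ⌈M⌉₊ := (Finset.mem_Ico.mp (Finset.mem_filter.mp hm).1).2
  rw [Finset.mem_Ico]
  refine ⟨Nat.one_le_iff_ne_zero.mpr (mul_ne_zero hq0.ne' (by omega)), Nat.lt_ceil.mpr ?_⟩
  have hmM' : (m : ℝ) < M := by
    have := Nat.lt_ceil.mp hmM
    exact_mod_cast this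
  have hq' : (0 : ℝ) < q := by exact_mod_cast hq0
  push_cast
  calc (q : ℝ) * m < q * M := by gcongr
    _ ≤ D := hqM

/-- The coefficients `b'_n = b_n [n ∣ P(u)]` are bounded by `1` and supported on squarefree `n`
(as the Corollary of Proposition 1 requires, p. 175). [folklore] -/
theorem indicator_coeff_admissible (u : ℝ) {b : ℕ → ℝ} (hb : ∀ n, |b n| ≤ 1) :
    (∀ n, |(fun n => if n ∣ primesProdBelow u then b n else 0) n| ≤ 1) ∧
      (∀ n, ¬ Squarefree n → (fun n => if n ∣ primesProdBelow u then b n else 0) n = 0) := by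
  constructor
  · intro n; dsimp only; split_ifs <;> simp [hb n]
  · intro n hn; dsimp only
    rw [if_neg (fun h => hn ((squarefree_primesProdBelow u).squarefree_of_dvd h))]


/-! ### `F ≥ 0` and `f ≥ 0` on all of `(0, ∞)` (forward stepping) -/

namespace IsLinearSieveFunctions

variable {F f : ℝ → ℝ}

/-- One forward step of the delay-differential system: if `F, f ≥ 0` on `(0, b]` with `b ≥ 3`, then
`F, f ≥ 0` on `(0, b + 1]` (`s F(s) = b F(b) + ∫_b^s f(t − 1) dt`, `s f(s) = b f(b) + ∫_b^s F(t − 1) dt`).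
[folklore] -/
theorem nonneg_step (h : IsLinearSieveFunctions F f) {b : ℝ} (hb : 3 ≤ b)
    (hF : ∀ s, 0 < s → s ≤ b → 0 ≤ F s) (hf : ∀ s, 0 < s → s ≤ b → 0 ≤ f s) :
    (∀ s, 0 < s → s ≤ b + 1 → 0 ≤ F s) ∧ (∀ s, 0 < s → s ≤ b + 1 → 0 ≤ f s) := by
  have keyF : ∀ s, b < s → s ≤ b + 1 → 0 ≤ F s := by
    intro s hbs hs1
    have hs0 : 0 < s := by linarith
    -- `s F(s) − b F(b) = ∫_b^s mulUpperDeriv f`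
    have hderiv : ∀ t ∈ Set.uIcc b s, HasDerivAt (fun y : ℝ => y * F y) (mulUpperDeriv f t) t := by
      intro t ht
      rw [Set.uIcc_of_le hbs.le] at ht
      exact h.hasDerivAt_mul_upper (by linarith [ht.1])
    have hcont : ContinuousOn (mulUpperDeriv f) (Set.uIcc b s) := by
      rw [Set.uIcc_of_le hbs.le]
      exact h.continuousOn_mulUpperDeriv.mono fun t ht => by
        simp only [Set.mem_Ioi]; linarith [ht.1]
    have hFTC := intervalIntegral.integral_eq_sub_of_hasDerivAt hderiv hcont.intervalIntegrable
    have hint : 0 ≤ ∫ t in b..s, mulUpperDeriv f t := by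
      refine intervalIntegral.integral_nonneg hbs.le fun t ht => ?_
      unfold mulUpperDeriv
      split_ifs with h3
      · exact le_rfl
      · exact hf (t - 1) (by linarith [ht.1]) (by linarith [ht.2])
    have hbF : 0 ≤ b * F b := mul_nonneg (by linarith) (hF b (by linarith) le_rfl)
    have hsF : 0 ≤ s * F s := by linarith
    exact (mul_nonneg_iff_of_pos_left hs0).mp hsF
  have keyf : ∀ s, b < s → s ≤ b + 1 → 0 ≤ f s := by
    intro s hbs hs1
    have hs0 : 0 < s := by linarith
    have hderiv : ∀ t ∈ Set.uIcc b s, HasDerivAt (fun y : ℝ => y * f y) (F (t - 1)) t := by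
      intro t ht
      rw [Set.uIcc_of_le hbs.le] at ht
      exact h.hasDerivAt_lower t (by linarith [ht.1])
    have hcont : ContinuousOn (fun t : ℝ => F (t - 1)) (Set.uIcc b s) := by
      rw [Set.uIcc_of_le hbs.le]
      refine h.continuousOn_upper.comp (continuousOn_id.sub continuousOn_const) fun t ht => ?_
      simp only [Set.mem_Ioi]; linarith [ht.1]
    have hFTC := intervalIntegral.integral_eq_sub_of_hasDerivAt hderiv hcont.intervalIntegrable
    have hint : 0 ≤ ∫ t in b..s, F (t - 1) :=
      intervalIntegral.integral_nonneg hbs.le fun t ht =>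
        hF (t - 1) (by linarith [ht.1]) (by linarith [ht.2])
    have hbf : 0 ≤ b * f b := mul_nonneg (by linarith) (hf b (by linarith) le_rfl)
    have hsf : 0 ≤ s * f s := by linarith
    exact (mul_nonneg_iff_of_pos_left hs0).mp hsf
  refine ⟨fun s hs0 hs1 => ?_, fun s hs0 hs1 => ?_⟩
  · rcases le_or_gt s b with hsb | hsb
    · exact hF s hs0 hsb
    · exact keyF s hsb hs1
  · rcases le_or_gt s b with hsb | hsb
    · exact hf s hs0 hsb
    · exact keyf s hsb hs1

/-- **`F(s) ≥ 0` and `f(s) ≥ 0` for all `s > 0`** (induction on unit steps from the elementary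
ranges `F = A/s` on `(0, 3]`, `f = 0` on `(0, 2]`, `f = A log(s−1)/s` on `[2, 4]`). [folklore] -/
theorem nonneg (h : IsLinearSieveFunctions F f) {s : ℝ} (hs : 0 < s) : 0 ≤ F s ∧ 0 ≤ f s := by
  -- `P n`: nonnegativity on `(0, n + 3]`
  have base : (∀ t : ℝ, 0 < t → t ≤ ((0 : ℕ) : ℝ) + 3 → 0 ≤ F t) ∧
      (∀ t : ℝ, 0 < t → t ≤ ((0 : ℕ) : ℝ) + 3 → 0 ≤ f t) := by
    refine ⟨fun t ht0 ht3 => ?_, fun t ht0 ht3 => ?_⟩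
    · rw [h.upper_eq_div ht0 (by push_cast at ht3; linarith)]
      exact div_nonneg (by unfold sieveA; positivity) ht0.le
    · rcases le_or_gt t 2 with ht2 | ht2
      · rw [h.lower_eq_zero ht0 ht2]
      · rw [h.lower_eq_log_div ht2.le (by push_cast at ht3; linarith)]
        exact div_nonneg (mul_nonneg (by unfold sieveA; positivity)
          (Real.log_nonneg (by linarith))) ht0.le
  have hP : ∀ n : ℕ, (∀ t : ℝ, 0 < t → t ≤ (n : ℝ) + 3 → 0 ≤ F t) ∧
      (∀ t : ℝ, 0 < t → t ≤ (n : ℝ) + 3 → 0 ≤ f t) := by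
    intro n
    induction n with
    | zero => exact base
    | succ n ih =>
      have := h.nonneg_step (b := (n : ℝ) + 3) (by linarith [(Nat.cast_nonneg n : (0 : ℝ) ≤ n)])
        ih.1 ih.2
      push_cast
      refine ⟨fun t ht0 ht1 => this.1 t ht0 (by linarith), fun t ht0 ht1 => this.2 t ht0 (by linarith)⟩
  obtain ⟨hF, hf⟩ := hP ⌈s⌉₊
  have hsle : s ≤ (⌈s⌉₊ : ℝ) + 3 := by linarith [Nat.le_ceil s]
  exact ⟨hF s hs hsle, hf s hs hsle⟩

/-- `G(s) = s F(s) ≥ 0` for `s > 0`. [folklore] -/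
theorem mul_upper_nonneg (h : IsLinearSieveFunctions F f) {s : ℝ} (hs : 0 < s) : 0 ≤ s * F s :=
  mul_nonneg hs.le (h.nonneg hs).1

end IsLinearSieveFunctions


/-! ### The main term of one `q`: comparison of `V(u) F(log MN / log u)` with the target -/

/-- `(1 + η)/(1 − η) ≤ 1 + 3η` for `0 ≤ η ≤ 1/3`. [folklore] -/
theorem one_add_div_one_sub_le {η : ℝ} (h0 : 0 ≤ η) (h1 : η ≤ 1 / 3) :
    (1 + η) / (1 - η) ≤ 1 + 3 * η := by
  rw [div_le_iff₀ (by linarith)]; nlinarith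

/-- `1/(1 − t) ≤ 1 + 2t` for `0 ≤ t ≤ 1/2`. [folklore] -/
theorem one_div_one_sub_le {t : ℝ} (h0 : 0 ≤ t) (h1 : t ≤ 1 / 2) : 1 / (1 - t) ≤ 1 + 2 * t := by
  rw [div_le_iff₀ (by linarith)]; nlinarith

set_option maxHeartbeats 800000 in
/-- **The main term of a single `q` in the proof of Proposition 2 (upper bound)** (p. 185 (21) and
p. 186: "`V(Z) = V(z)(log z/log z_q)(1 + O(1/log z))`" and
"`F(log(y/Qx^{2ε})/log Z) = F(log(y/q)/log z_q) + O_γ(ε)`"), in explicit form.  With `L = log x`,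
`z = x^γ`, sieving level `u = min(Z_c, (MN)^{1/2})` for a class floor `Z_c ≤ z_q < 2Z_c`,
`log MN ∈ [log(y/q) − 6ε'L, log(y/q)]`, and `Λ(t) = V(t) log t` within `εΛ₀/8` of `Λ₀` at
`t = u, z`: `V(u) F(log MN/log u) ≤ (V(z) log z/log z_q)(F(log(y/q)/log z_q) + C₃ ε)` with
`C₃ = 10(G_max + 4 L_G/γ)`, `G(s) = s F(s)`.  In the case `u = (MN)^{1/2}` both arguments lie in
`(0, 3]`, where `s F(s) = A` is constant. [cite: IwaniecInventiones1978, §5 pp. 185–186] -/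
theorem main_term_upper {F f : ℝ → ℝ} (hFf : IsLinearSieveFunctions F f) {γ : ℝ} (hγ : 0 < γ)
    (hγ2 : γ < 1 / 2) {Lg : NNReal} {Gmax : ℝ}
    (hLip : LipschitzOnWith Lg (fun s : ℝ => s * F s) (Set.Icc (1 / 10) (16 / (15 * γ) + 2)))
    (hGmax : ∀ s ∈ Set.Icc (1 / 10 : ℝ) (16 / (15 * γ) + 2), |s * F s| ≤ Gmax)
    {ε ε' x zq Zc MN u : ℝ} {q : ℕ} (hε : 0 < ε) (hε1 : ε ≤ 1) (hε' : 0 ≤ ε') (hε'ε : ε' ≤ ε / 1000)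
    (hx : 1 < x) (hlogx : 1 / Real.log x ≤ ε * γ / 2)
    (hzq : x ^ γ ≤ zq ∧ zq < x ^ (1 / 2 : ℝ)) (hq : 1 ≤ q ∧ (q : ℝ) < x ^ (1 - ε))
    (hZc : Zc ≤ zq ∧ zq < 2 * Zc ∧ x ^ γ ≤ Zc) (hMN0 : 0 < MN)
    (hMN : Real.log (x ^ (16 / 15 : ℝ) / q) - 6 * ε' * Real.log x ≤ Real.log MN ∧
      Real.log MN ≤ Real.log (x ^ (16 / 15 : ℝ) / q))
    (hu : u = min Zc (MN ^ (1 / 2 : ℝ)))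
    (hΛu : |densityProd u * Real.log u - lambda0| ≤ ε / 8 * lambda0)
    (hΛz : |densityProd (x ^ γ) * Real.log (x ^ γ) - lambda0| ≤ ε / 8 * lambda0) :
    densityProd u * F (Real.log MN / Real.log u) ≤
      densityProd (x ^ γ) * Real.log (x ^ γ) / Real.log zq *
        (F (Real.log (x ^ (16 / 15 : ℝ) / q) / Real.log zq) + 10 * (Gmax + 4 * Lg / γ) * ε) := by
  -- notation and positivity
  have hx0 : 0 < x := by linarith
  set L := Real.log x with hL
  have hL0 : 0 < L := Real.log_pos hx
  have hεL : 0 < ε * L := mul_pos hε hL0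
  have hlz : Real.log (x ^ γ) = γ * L := Real.log_rpow hx0 γ
  have hγL : 0 < γ * L := mul_pos hγ hL0
  have hq0 : (0 : ℝ) < q := by exact_mod_cast hq.1
  have hq1 : (1 : ℝ) ≤ q := by exact_mod_cast hq.1
  set lyq := Real.log (x ^ (16 / 15 : ℝ) / q) with hlyq
  have hlyq_eq : lyq = 16 / 15 * L - Real.log q := by
    rw [hlyq, Real.log_div (by positivity) hq0.ne', Real.log_rpow hx0]
  have hlogq0 : 0 ≤ Real.log q := Real.log_nonneg hq1
  have hlogq : Real.log q < (1 - ε) * L := by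
    rw [← Real.log_rpow hx0]; exact Real.log_lt_log hq0 hq.2
  have hlyq_lo : L / 15 < lyq := by rw [hlyq_eq]; linarith
  have hlyq_hi : lyq ≤ 16 / 15 * L := by rw [hlyq_eq]; linarith
  have hlyq0 : 0 < lyq := lt_trans (by positivity) hlyq_lo
  have hzq0 : 0 < zq := lt_of_lt_of_le (Real.rpow_pos_of_pos hx0 γ) hzq.1
  set lzq := Real.log zq with hlzq
  have hlzq_lo : γ * L ≤ lzq := by
    rw [← hlz]; exact Real.log_le_log (Real.rpow_pos_of_pos hx0 γ) hzq.1
  have hlzq_hi : lzq < L / 2 := by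
    have := Real.log_lt_log hzq0 hzq.2
    rw [Real.log_rpow hx0] at this; linarith
  have hlzq0 : 0 < lzq := lt_of_lt_of_le hγL hlzq_lo
  set lMN := Real.log MN with hlMN
  have hε'L : 6 * ε' * L ≤ 90 * ε' * lyq := by
    have := mul_le_mul_of_nonneg_left (show L ≤ 15 * lyq by linarith) (show 0 ≤ 6 * ε' by positivity)
    linarith
  have hlMN_lo : lyq * (1 - 90 * ε') ≤ lMN := by linarith [hMN.1]
  have h90 : 90 * ε' ≤ 9 / 100 := by linarith
  have hlyq91 : lyq * (91 / 100) ≤ lyq * (1 - 90 * ε') :=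
    mul_le_mul_of_nonneg_left (by linarith) hlyq0.le
  have hlMN0 : 0 < lMN :=
    lt_of_lt_of_le (by positivity : 0 < lyq * (91 / 100)) (hlyq91.trans hlMN_lo)
  have hZc0 : 0 < Zc := lt_of_lt_of_le (Real.rpow_pos_of_pos hx0 γ) hZc.2.2
  have hsqrt0 : 0 < MN ^ (1 / 2 : ℝ) := Real.rpow_pos_of_pos hMN0 _
  have hlsqrt : Real.log (MN ^ (1 / 2 : ℝ)) = lMN / 2 := by
    rw [Real.log_rpow hMN0]; ring
  have hu0 : 0 < u := by rw [hu]; exact lt_min hZc0 hsqrt0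
  set lu := Real.log u with hlu
  have hlu_le : lu ≤ lMN / 2 := by
    rw [hlu, ← hlsqrt]; exact Real.log_le_log hu0 (by rw [hu]; exact min_le_right _ _)
  have hlZc_lo : γ * L ≤ Real.log Zc := by
    rw [← hlz]; exact Real.log_le_log (Real.rpow_pos_of_pos hx0 γ) hZc.2.2
  have hlu0 : 0 < lu := by
    rw [hlu, hu]
    rcases min_choice Zc (MN ^ (1 / 2 : ℝ)) with h | h <;> rw [h]
    · exact lt_of_lt_of_le hγL hlZc_lo
    · rw [hlsqrt]; linarith
  -- the quantities `Λ`
  set Λu := densityProd u * lu with hΛu_def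
  set Λz := densityProd (x ^ γ) * Real.log (x ^ γ) with hΛz_def
  have hΛ0 := lambda0_pos
  have hΛu_hi : Λu ≤ (1 + ε / 8) * lambda0 := by
    have := (abs_le.mp hΛu).2; linarith
  have hΛz_lo : (1 - ε / 8) * lambda0 ≤ Λz := by
    have := (abs_le.mp hΛz).1; linarith
  have hΛz0 : 0 < Λz := lt_of_lt_of_le (mul_pos (by linarith) hΛ0) hΛz_lo
  have hΛu0 : 0 ≤ Λu := mul_nonneg (densityProd_pos u).le hlu0.le
  have hΛuz : Λu ≤ Λz * (1 + 3 * (ε / 8)) := by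
    have hlam : lambda0 ≤ Λz / (1 - ε / 8) := by
      rw [le_div_iff₀ (by linarith)]; linarith
    have h2 : (1 + ε / 8) / (1 - ε / 8) ≤ 1 + 3 * (ε / 8) :=
      one_add_div_one_sub_le (by linarith) (by linarith)
    calc Λu ≤ (1 + ε / 8) * lambda0 := hΛu_hi
      _ ≤ (1 + ε / 8) * (Λz / (1 - ε / 8)) := mul_le_mul_of_nonneg_left hlam (by linarith)
      _ = Λz * ((1 + ε / 8) / (1 - ε / 8)) := by ring
      _ ≤ Λz * (1 + 3 * (ε / 8)) := mul_le_mul_of_nonneg_left h2 hΛz0.le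
  -- the arguments `s_u`, `s_q` and their ranges
  set su := lMN / lu with hsu
  set sq := lyq / lzq with hsq
  have hSγ : 16 / (15 * γ) = (16 / 15) / γ := by rw [div_div]
  have hsu_lo : 2 ≤ su := by
    rw [hsu, le_div_iff₀ hlu0]; linarith
  have hsq_lo : 1 / 10 < sq := by
    rw [hsq, lt_div_iff₀ hlzq0]; linarith
  have hsq_hi : sq ≤ 16 / (15 * γ) := by
    rw [hsq, div_le_iff₀ hlzq0, hSγ, div_mul_eq_mul_div, le_div_iff₀ hγ]
    calc lyq * γ ≤ 16 / 15 * L * γ := mul_le_mul_of_nonneg_right hlyq_hi hγ.le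
      _ = 16 / 15 * (γ * L) := by ring
      _ ≤ 16 / 15 * lzq := mul_le_mul_of_nonneg_left hlzq_lo (by norm_num)
  have hsq_mem : sq ∈ Set.Icc (1 / 10 : ℝ) (16 / (15 * γ) + 2) := ⟨hsq_lo.le, by linarith⟩
  have hsq0 : 0 < sq := by linarith
  -- `G ≥ 0`
  have hGsu : 0 ≤ su * F su := hFf.mul_upper_nonneg (by linarith)
  have hGsq : 0 ≤ sq * F sq := hFf.mul_upper_nonneg hsq0
  have hGsq_le : sq * F sq ≤ Gmax := (le_abs_self _).trans (hGmax sq hsq_mem)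
  have hLg0 : (0 : ℝ) ≤ Lg := NNReal.coe_nonneg _
  -- (iii) `G(s_u) ≤ G(s_q) + 2 L_G ε/γ`
  have hG : su * F su ≤ sq * F sq + 2 * Lg * ε / γ := by
    rcases le_or_gt Zc (MN ^ (1 / 2 : ℝ)) with hcase | hcase
    · -- Case A: `u = Zc`
      have huZ : u = Zc := by rw [hu, min_eq_left hcase]
      have hlu_hi : lzq < lu + Real.log 2 := by
        rw [hlu, huZ, ← Real.log_mul hZc0.ne' (by norm_num)]
        exact Real.log_lt_log hzq0 (by linarith [hZc.2.1])
      have hlu_le_lzq : lu ≤ lzq := by rw [hlu, huZ]; exact Real.log_le_log hZc0 hZc.1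
      have hlu_lo : γ * L ≤ lu := by rw [hlu, huZ]; exact hlZc_lo
      have hsu_hi : su ≤ 16 / (15 * γ) := by
        rw [hsu, div_le_iff₀ hlu0, hSγ, div_mul_eq_mul_div, le_div_iff₀ hγ]
        calc lMN * γ ≤ 16 / 15 * L * γ :=
              mul_le_mul_of_nonneg_right (hMN.2.trans hlyq_hi) hγ.le
          _ = 16 / 15 * (γ * L) := by ring
          _ ≤ 16 / 15 * lu := mul_le_mul_of_nonneg_left hlu_lo (by norm_num)
      have hsu_mem : su ∈ Set.Icc (1 / 10 : ℝ) (16 / (15 * γ) + 2) := ⟨by linarith, by linarith⟩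
      -- `|su − sq| ≤ 2ε/γ`
      have hlog2 : Real.log 2 < 0.75 := by have := Real.log_two_lt_d9; linarith
      have hdiff : |su - sq| ≤ 2 * ε / γ := by
        have e : su - sq = (lMN - lyq) / lu + lyq * (lzq - lu) / (lu * lzq) := by
          rw [hsu, hsq]; field_simp; ring
        rw [e]
        have hA : |(lMN - lyq) / lu| ≤ 6 * ε' / γ := by
          rw [abs_div, abs_of_pos hlu0, div_le_div_iff₀ hlu0 hγ]
          have h6 : 0 ≤ 6 * ε' * L := by positivity
          have habs : |lMN - lyq| ≤ 6 * ε' * L := by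
            rw [abs_le]; constructor <;> linarith [hMN.1, hMN.2]
          calc |lMN - lyq| * γ ≤ 6 * ε' * L * γ := mul_le_mul_of_nonneg_right habs hγ.le
            _ = 6 * ε' * (γ * L) := by ring
            _ ≤ 6 * ε' * lu := mul_le_mul_of_nonneg_left hlu_lo (by positivity)
        have hB : |lyq * (lzq - lu) / (lu * lzq)| ≤ ε / γ := by
          rw [abs_div, abs_mul, abs_of_pos hlyq0, abs_of_nonneg (by linarith),
            abs_of_pos (by positivity), div_le_div_iff₀ (by positivity) hγ]
          have h1 : lyq * (lzq - lu) * γ ≤ 16 / 15 * L * Real.log 2 * γ := by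
            have : lyq * (lzq - lu) ≤ 16 / 15 * L * Real.log 2 :=
              mul_le_mul hlyq_hi (by linarith) (by linarith) (by positivity)
            exact mul_le_mul_of_nonneg_right this hγ.le
          have hεγL : 2 ≤ ε * γ * L := by
            have := (div_le_iff₀ hL0).mp hlogx; linarith
          have h3 : 16 / 15 * L * Real.log 2 * γ ≤ ε * (lu * lzq) := by
            calc 16 / 15 * L * Real.log 2 * γ = (16 / 15 * Real.log 2) * (γ * L) := by ring
              _ ≤ 2 * (γ * L) := mul_le_mul_of_nonneg_right (by linarith) hγL.le
              _ ≤ (ε * γ * L) * (γ * L) := mul_le_mul_of_nonneg_right hεγL hγL.le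
              _ = ε * ((γ * L) * (γ * L)) := by ring
              _ ≤ ε * (lu * lzq) := mul_le_mul_of_nonneg_left
                  (mul_le_mul hlu_lo hlzq_lo hγL.le hlu0.le) hε.le
          linarith
        calc |(lMN - lyq) / lu + lyq * (lzq - lu) / (lu * lzq)|
            ≤ |(lMN - lyq) / lu| + |lyq * (lzq - lu) / (lu * lzq)| := abs_add_le _ _
          _ ≤ 6 * ε' / γ + ε / γ := add_le_add hA hB
          _ ≤ 2 * ε / γ := by
              rw [← add_div]; exact div_le_div_of_nonneg_right (by linarith) hγ.le
      have hLd := hLip.dist_le_mul su hsu_mem sq hsq_mem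
      rw [Real.dist_eq, Real.dist_eq] at hLd
      have : su * F su - sq * F sq ≤ Lg * (2 * ε / γ) :=
        (le_abs_self _).trans (hLd.trans (mul_le_mul_of_nonneg_left hdiff hLg0))
      have e2 : (Lg : ℝ) * (2 * ε / γ) = 2 * Lg * ε / γ := by ring
      linarith
    · -- Case B: `u = (MN)^{1/2}`, `su = 2`, `sq ≤ 3`: both `G` values equal `A`
      have huS : u = MN ^ (1 / 2 : ℝ) := by rw [hu, min_eq_right hcase.le]
      have hlu_eq : lu = lMN / 2 := by rw [hlu, huS, hlsqrt]
      have hsu2 : su = 2 := by rw [hsu, hlu_eq]; field_simp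
      have hlzq_gt : lMN / 2 < lzq := by
        rw [← hlsqrt, hlzq]; exact Real.log_lt_log hsqrt0 (lt_of_lt_of_le hcase hZc.1)
      have hsq3 : sq ≤ 3 := by
        rw [hsq, div_le_iff₀ hlzq0]
        linarith [hlMN_lo, hlyq91]
      have hGu : su * F su = sieveA := by rw [hsu2]; exact hFf.upper_eq 2 two_pos (by norm_num)
      have hGq : sq * F sq = sieveA := hFf.upper_eq sq hsq0 hsq3
      rw [hGu, ← hGq]
      have : 0 ≤ 2 * Lg * ε / γ := by positivity
      linarith
  -- (ii) `1/lMN ≤ (1 + 180 ε')/lyq`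
  have hinvMN : 1 / lMN ≤ (1 + 180 * ε') / lyq := by
    rw [div_le_div_iff₀ hlMN0 hlyq0, one_mul]
    have h1 := one_div_one_sub_le (by positivity : 0 ≤ 90 * ε') (by linarith)
    have h2 : lyq ≤ lMN * (1 / (1 - 90 * ε')) := by
      rw [mul_one_div, le_div_iff₀ (by linarith)]; linarith
    calc lyq ≤ lMN * (1 / (1 - 90 * ε')) := h2
      _ ≤ lMN * (1 + 2 * (90 * ε')) := mul_le_mul_of_nonneg_left h1 hlMN0.le
      _ = (1 + 180 * ε') * lMN := by ring
  -- rewrite both sides through `G`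
  have hLHS : densityProd u * F su = Λu * (su * F su) * (1 / lMN) := by
    have : densityProd u = Λu / lu := by rw [hΛu_def]; field_simp
    rw [this, hsu]; field_simp
  have hRHS : Λz / lzq * (F sq + 10 * (Gmax + 4 * Lg / γ) * ε) =
      Λz * (sq * F sq) * (1 / lyq) + Λz / lzq * (10 * (Gmax + 4 * Lg / γ) * ε) := by
    rw [hsq]; field_simp
  rw [hLHS, hRHS]
  -- combine (i), (ii), (iii)
  have hκ : (1 + 3 * (ε / 8)) * (1 + 180 * ε') ≤ 1 + 0.7 * ε := by
    have h1 : ε * ε' ≤ ε * (ε / 1000) := mul_le_mul_of_nonneg_left hε'ε hε.le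
    have h2 : ε * ε ≤ ε := mul_le_of_le_one_right hε.le hε1
    have e : (1 + 3 * (ε / 8)) * (1 + 180 * ε') = 1 + 180 * ε' + 3 / 8 * ε + 135 / 2 * (ε * ε') := by
      ring
    rw [e]; linarith
  have hGL : 0 ≤ Gmax + 4 * Lg / γ := by
    have : 0 ≤ Gmax := hGsq.trans hGsq_le
    positivity
  have step1 : Λu * (su * F su) * (1 / lMN) ≤
      Λz * (1 + 3 * (ε / 8)) * (sq * F sq + 2 * Lg * ε / γ) * ((1 + 180 * ε') / lyq) := by
    have h1 : Λu * (su * F su) ≤ Λz * (1 + 3 * (ε / 8)) * (sq * F sq + 2 * Lg * ε / γ) :=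
      mul_le_mul hΛuz hG hGsu (by positivity)
    exact mul_le_mul h1 hinvMN (by positivity) (by positivity)
  have step2 : Λz * (1 + 3 * (ε / 8)) * (sq * F sq + 2 * Lg * ε / γ) * ((1 + 180 * ε') / lyq) ≤
      Λz * (sq * F sq) * (1 / lyq) + Λz * (1 / lyq) * (ε * (Gmax + 4 * Lg / γ)) := by
    have e : Λz * (1 + 3 * (ε / 8)) * (sq * F sq + 2 * Lg * ε / γ) * ((1 + 180 * ε') / lyq) =
        Λz * (1 / lyq) * (((1 + 3 * (ε / 8)) * (1 + 180 * ε')) * (sq * F sq + 2 * Lg * ε / γ)) := by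
      field_simp
    rw [e, show Λz * (sq * F sq) * (1 / lyq) + Λz * (1 / lyq) * (ε * (Gmax + 4 * Lg / γ)) =
      Λz * (1 / lyq) * (sq * F sq + ε * (Gmax + 4 * Lg / γ)) by ring]
    refine mul_le_mul_of_nonneg_left ?_ (by positivity)
    have hLgγ : 0 ≤ (Lg : ℝ) / γ := by positivity
    have hin : 0.7 * (sq * F sq) + 2 * (Lg / γ) * (1 + 0.7 * ε) ≤ Gmax + 4 * Lg / γ := by
      have h3 : 2 * (Lg / γ) * (1 + 0.7 * ε) ≤ 2 * (Lg / γ) * 2 :=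
        mul_le_mul_of_nonneg_left (by linarith) (by positivity)
      have h4 : 0.7 * (sq * F sq) ≤ Gmax := by linarith
      have e3 : 2 * ((Lg : ℝ) / γ) * 2 = 4 * Lg / γ := by ring
      linarith
    calc (1 + 3 * (ε / 8)) * (1 + 180 * ε') * (sq * F sq + 2 * Lg * ε / γ)
        ≤ (1 + 0.7 * ε) * (sq * F sq + 2 * Lg * ε / γ) :=
          mul_le_mul_of_nonneg_right hκ (by positivity)
      _ = sq * F sq + ε * (0.7 * (sq * F sq) + 2 * (Lg / γ) * (1 + 0.7 * ε)) := by ring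
      _ ≤ sq * F sq + ε * (Gmax + 4 * Lg / γ) := by
          have := mul_le_mul_of_nonneg_left hin hε.le
          linarith
  have step3 : Λz * (1 / lyq) * (ε * (Gmax + 4 * Lg / γ)) ≤
      Λz / lzq * (10 * (Gmax + 4 * Lg / γ) * ε) := by
    have h1 : 1 / lyq ≤ 10 / lzq := by
      rw [div_le_div_iff₀ hlyq0 hlzq0]
      have : lzq < 10 * lyq := by
        rw [hsq, lt_div_iff₀ hlzq0] at hsq_lo; linarith
      linarith
    calc Λz * (1 / lyq) * (ε * (Gmax + 4 * Lg / γ))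
        ≤ Λz * (10 / lzq) * (ε * (Gmax + 4 * Lg / γ)) := by
          refine mul_le_mul_of_nonneg_right (mul_le_mul_of_nonneg_left h1 hΛz0.le) ?_
          positivity
      _ = Λz / lzq * (10 * (Gmax + 4 * Lg / γ) * ε) := by ring
  linarith [step1, step2, step3]


set_option maxHeartbeats 400000 in
/-- **`V(u)` against the target density** (p. 186): with `u = min(Z_c, (MN)^{1/2})` as above and
`Λ` within `λ₀/8` of `λ₀` at `u` and `z = x^γ`, `V(u) ≤ (V(z) log z / log z_q)(1/γ + 33)`
(`log u ≥ min(γ, 1/33) log x`). Used to absorb Lemma 2's `E`-term. [cite: IwaniecInventiones1978, §5 p. 186] -/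
theorem densityProd_level_le {γ ε ε' x zq Zc MN u : ℝ} {q : ℕ} (hγ : 0 < γ)
    (hε : 0 < ε) (hε1 : ε ≤ 1) (hε' : 0 ≤ ε') (hε'ε : ε' ≤ ε / 1000) (hx : 1 < x)
    (hzq : x ^ γ ≤ zq ∧ zq < x ^ (1 / 2 : ℝ)) (hq : 1 ≤ q ∧ (q : ℝ) < x ^ (1 - ε))
    (hZc : Zc ≤ zq ∧ x ^ γ ≤ Zc) (hMN0 : 0 < MN)
    (hMN : Real.log (x ^ (16 / 15 : ℝ) / q) - 6 * ε' * Real.log x ≤ Real.log MN)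
    (hu : u = min Zc (MN ^ (1 / 2 : ℝ)))
    (hΛu : |densityProd u * Real.log u - lambda0| ≤ ε / 8 * lambda0)
    (hΛz : |densityProd (x ^ γ) * Real.log (x ^ γ) - lambda0| ≤ ε / 8 * lambda0) :
    densityProd u ≤ densityProd (x ^ γ) * Real.log (x ^ γ) / Real.log zq * (1 / γ + 33) := by
  have hx0 : 0 < x := by linarith
  set L := Real.log x with hL
  have hL0 : 0 < L := Real.log_pos hx
  have hεL : 0 < ε * L := mul_pos hε hL0
  have hlz : Real.log (x ^ γ) = γ * L := Real.log_rpow hx0 γ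
  have hγL : 0 < γ * L := mul_pos hγ hL0
  have hq0 : (0 : ℝ) < q := by exact_mod_cast hq.1
  have hq1 : (1 : ℝ) ≤ q := by exact_mod_cast hq.1
  set lyq := Real.log (x ^ (16 / 15 : ℝ) / q) with hlyq
  have hlyq_eq : lyq = 16 / 15 * L - Real.log q := by
    rw [hlyq, Real.log_div (by positivity) hq0.ne', Real.log_rpow hx0]
  have hlogq : Real.log q < (1 - ε) * L := by
    rw [← Real.log_rpow hx0]; exact Real.log_lt_log hq0 hq.2
  have hlyq_lo : L / 15 < lyq := by rw [hlyq_eq]; linarith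
  have hlyq0 : 0 < lyq := lt_trans (by positivity) hlyq_lo
  have hzq0 : 0 < zq := lt_of_lt_of_le (Real.rpow_pos_of_pos hx0 γ) hzq.1
  set lzq := Real.log zq with hlzq
  have hlzq_hi : lzq < L / 2 := by
    have := Real.log_lt_log hzq0 hzq.2
    rw [Real.log_rpow hx0] at this; linarith
  have hlzq_lo : γ * L ≤ lzq := by
    rw [← hlz]; exact Real.log_le_log (Real.rpow_pos_of_pos hx0 γ) hzq.1
  have hlzq0 : 0 < lzq := lt_of_lt_of_le hγL hlzq_lo
  set lMN := Real.log MN with hlMN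
  have hε'L : 6 * ε' * L ≤ 90 * ε' * lyq := by
    have := mul_le_mul_of_nonneg_left (show L ≤ 15 * lyq by linarith) (show 0 ≤ 6 * ε' by positivity)
    linarith
  have h90 : 90 * ε' ≤ 9 / 100 := by linarith
  have hlyq91 : lyq * (91 / 100) ≤ lyq * (1 - 90 * ε') :=
    mul_le_mul_of_nonneg_left (by linarith) hlyq0.le
  have hlMN_lo : L / 33 ≤ lMN / 2 := by linarith [hMN, hε'L, hlyq91, hlyq_lo]
  have hZc0 : 0 < Zc := lt_of_lt_of_le (Real.rpow_pos_of_pos hx0 γ) hZc.2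
  have hsqrt0 : 0 < MN ^ (1 / 2 : ℝ) := Real.rpow_pos_of_pos hMN0 _
  have hlsqrt : Real.log (MN ^ (1 / 2 : ℝ)) = lMN / 2 := by
    rw [Real.log_rpow hMN0]; ring
  have hu0 : 0 < u := by rw [hu]; exact lt_min hZc0 hsqrt0
  set lu := Real.log u with hlu
  have hlZc_lo : γ * L ≤ Real.log Zc := by
    rw [← hlz]; exact Real.log_le_log (Real.rpow_pos_of_pos hx0 γ) hZc.2
  -- `lu ≥ min(γ, 1/33) L`
  set a : ℝ := min γ (1 / 33) with ha
  have ha0 : 0 < a := lt_min hγ (by norm_num)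
  have haL : a * L ≤ lu := by
    rw [hlu, hu]
    rcases min_choice Zc (MN ^ (1 / 2 : ℝ)) with h | h <;> rw [h]
    · calc a * L ≤ γ * L := mul_le_mul_of_nonneg_right (min_le_left _ _) hL0.le
        _ ≤ Real.log Zc := hlZc_lo
    · rw [hlsqrt]
      calc a * L ≤ 1 / 33 * L := mul_le_mul_of_nonneg_right (min_le_right _ _) hL0.le
        _ ≤ lMN / 2 := by linarith
  have hlu0 : 0 < lu := lt_of_lt_of_le (mul_pos ha0 hL0) haL
  set Λu := densityProd u * lu with hΛu_def
  set Λz := densityProd (x ^ γ) * Real.log (x ^ γ) with hΛz_def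
  have hΛ0 := lambda0_pos
  have hε8 : ε / 8 * lambda0 ≤ 1 / 8 * lambda0 := mul_le_mul_of_nonneg_right (by linarith) hΛ0.le
  have hΛu_hi : Λu ≤ 9 / 8 * lambda0 := by
    have := (abs_le.mp hΛu).2; linarith
  have hΛz_lo : 7 / 8 * lambda0 ≤ Λz := by
    have := (abs_le.mp hΛz).1; linarith
  have hΛz0 : 0 < Λz := lt_of_lt_of_le (by positivity) hΛz_lo
  -- `V(u) = Λu/lu ≤ (9/8)λ₀/(aL)` and `Λz/lzq ≥ (7/8)λ₀/(L/2)`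
  have hV : densityProd u = Λu / lu := by rw [hΛu_def]; field_simp
  rw [hV]
  have h1 : Λu / lu ≤ 9 / 8 * lambda0 / (a * L) := by
    rw [div_le_div_iff₀ hlu0 (mul_pos ha0 hL0)]
    calc Λu * (a * L) ≤ 9 / 8 * lambda0 * (a * L) := mul_le_mul_of_nonneg_right hΛu_hi (by positivity)
      _ ≤ 9 / 8 * lambda0 * lu := mul_le_mul_of_nonneg_left haL (by positivity)
  have h2 : 7 / 4 * lambda0 / L ≤ Λz / lzq := by
    rw [div_le_div_iff₀ hL0 hlzq0]
    calc 7 / 4 * lambda0 * lzq ≤ 7 / 4 * lambda0 * (L / 2) := mul_le_mul_of_nonneg_left hlzq_hi.le (by positivity)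
      _ = 7 / 8 * lambda0 * L := by ring
      _ ≤ Λz * L := mul_le_mul_of_nonneg_right hΛz_lo hL0.le
  have h3 : 1 / a ≤ 1 / γ + 33 := by
    rw [ha]
    rcases min_choice γ (1 / 33) with h | h <;> rw [h]
    · linarith
    · have : 0 < 1 / γ := by positivity
      norm_num; linarith
  calc Λu / lu ≤ 9 / 8 * lambda0 / (a * L) := h1
    _ = (7 / 4 * lambda0 / L) * ((9 / 14) * (1 / a)) := by field_simp; ring
    _ ≤ (Λz / lzq) * ((9 / 14) * (1 / a)) := mul_le_mul_of_nonneg_right h2 (by positivity)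
    _ ≤ (Λz / lzq) * (1 / γ + 33) := by
        refine mul_le_mul_of_nonneg_left ?_ (by positivity)
        have : 0 < 1 / a := by positivity
        linarith

set_option maxHeartbeats 400000 in
/-- **The main term of a single `q` for the lower bound at a constant level `Z ≤ (MN)^{1/2}`**
("A similar result holds for lower bound, the function `F(s)` being replaced by `f(s)`", p. 185):
`V(Z) f(log MN/log Z) ≥ (V(z) log z/log Z)(f(log(y/q)/log Z) − (L_f/γ + f_max) ε)`.
[cite: IwaniecInventiones1978, Proposition 2] -/
theorem main_term_lower {F f : ℝ → ℝ} (hFf : IsLinearSieveFunctions F f) {γ : ℝ} (hγ : 0 < γ)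
    (hγ2 : γ < 1 / 2) {Lf : NNReal} {fmax : ℝ}
    (hLip : LipschitzOnWith Lf f (Set.Icc (1 / 10) (16 / (15 * γ) + 2)))
    (hfmax : ∀ s ∈ Set.Icc (1 / 10 : ℝ) (16 / (15 * γ) + 2), |f s| ≤ fmax)
    {ε ε' x Z MN : ℝ} {q : ℕ} (hε : 0 < ε) (hε1 : ε ≤ 1) (hε' : 0 ≤ ε') (hε'ε : ε' ≤ ε / 1000)
    (hx : 1 < x) (hZ : x ^ γ ≤ Z ∧ Z < x ^ (1 / 2 : ℝ)) (hq : 1 ≤ q ∧ (q : ℝ) < x ^ (1 - ε))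
    (hMN0 : 0 < MN) (hZMN : Z ≤ MN ^ (1 / 2 : ℝ))
    (hMN : Real.log (x ^ (16 / 15 : ℝ) / q) - 6 * ε' * Real.log x ≤ Real.log MN ∧
      Real.log MN ≤ Real.log (x ^ (16 / 15 : ℝ) / q))
    (hΛZ : |densityProd Z * Real.log Z - lambda0| ≤ ε / 8 * lambda0)
    (hΛz : |densityProd (x ^ γ) * Real.log (x ^ γ) - lambda0| ≤ ε / 8 * lambda0) :
    densityProd (x ^ γ) * Real.log (x ^ γ) / Real.log Z *
        (f (Real.log (x ^ (16 / 15 : ℝ) / q) / Real.log Z) - (Lf / γ + fmax) * ε) ≤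
      densityProd Z * f (Real.log MN / Real.log Z) := by
  have hx0 : 0 < x := by linarith
  set L := Real.log x with hL
  have hL0 : 0 < L := Real.log_pos hx
  have hεL : 0 < ε * L := mul_pos hε hL0
  have hlz : Real.log (x ^ γ) = γ * L := Real.log_rpow hx0 γ
  have hγL : 0 < γ * L := mul_pos hγ hL0
  have hq0 : (0 : ℝ) < q := by exact_mod_cast hq.1
  have hq1 : (1 : ℝ) ≤ q := by exact_mod_cast hq.1
  set lyq := Real.log (x ^ (16 / 15 : ℝ) / q) with hlyq
  have hlyq_eq : lyq = 16 / 15 * L - Real.log q := by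
    rw [hlyq, Real.log_div (by positivity) hq0.ne', Real.log_rpow hx0]
  have hlogq0 : 0 ≤ Real.log q := Real.log_nonneg hq1
  have hlogq : Real.log q < (1 - ε) * L := by
    rw [← Real.log_rpow hx0]; exact Real.log_lt_log hq0 hq.2
  have hlyq_lo : L / 15 < lyq := by rw [hlyq_eq]; linarith
  have hlyq_hi : lyq ≤ 16 / 15 * L := by rw [hlyq_eq]; linarith
  have hlyq0 : 0 < lyq := lt_trans (by positivity) hlyq_lo
  have hZ0 : 0 < Z := lt_of_lt_of_le (Real.rpow_pos_of_pos hx0 γ) hZ.1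
  set lZ := Real.log Z with hlZ
  have hlZ_lo : γ * L ≤ lZ := by
    rw [← hlz]; exact Real.log_le_log (Real.rpow_pos_of_pos hx0 γ) hZ.1
  have hlZ_hi : lZ < L / 2 := by
    have := Real.log_lt_log hZ0 hZ.2
    rw [Real.log_rpow hx0] at this; linarith
  have hlZ0 : 0 < lZ := lt_of_lt_of_le hγL hlZ_lo
  set lMN := Real.log MN with hlMN
  have hlMN0 : 0 < lMN := by
    have hε'L : 6 * ε' * L ≤ 90 * ε' * lyq := by
      have := mul_le_mul_of_nonneg_left (show L ≤ 15 * lyq by linarith) (show 0 ≤ 6 * ε' by positivity)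
      linarith
    have hlyq91 : lyq * (91 / 100) ≤ lyq * (1 - 90 * ε') :=
      mul_le_mul_of_nonneg_left (by linarith) hlyq0.le
    have h0 : 0 < lyq * (91 / 100) := by positivity
    linarith [hMN.1]
  -- `Λ`
  set ΛZ := densityProd Z * lZ with hΛZ_def
  set Λz := densityProd (x ^ γ) * Real.log (x ^ γ) with hΛz_def
  have hΛ0 := lambda0_pos
  have hΛZ_lo : (1 - ε / 8) * lambda0 ≤ ΛZ := by
    have := (abs_le.mp hΛZ).1; linarith
  have hΛz_hi : Λz ≤ (1 + ε / 8) * lambda0 := by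
    have := (abs_le.mp hΛz).2; linarith
  have hΛz_lo : (1 - ε / 8) * lambda0 ≤ Λz := by
    have := (abs_le.mp hΛz).1; linarith
  have hΛz0 : 0 < Λz := lt_of_lt_of_le (mul_pos (by linarith) hΛ0) hΛz_lo
  have hΛZ0 : 0 ≤ ΛZ := mul_nonneg (densityProd_pos Z).le hlZ0.le
  -- `ΛZ ≥ Λz (1 − ε/4)`
  have hΛZz : Λz * (1 - ε / 4) ≤ ΛZ := by
    have h1 : Λz * (1 - ε / 4) ≤ (1 + ε / 8) * lambda0 * (1 - ε / 4) :=
      mul_le_mul_of_nonneg_right hΛz_hi (by linarith)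
    have h2 : 0 ≤ ε ^ 2 / 32 * lambda0 := by positivity
    have e : (1 + ε / 8) * lambda0 * (1 - ε / 4) = (1 - ε / 8) * lambda0 - ε ^ 2 / 32 * lambda0 := by
      ring
    linarith
  -- arguments
  set su := lMN / lZ with hsu
  set sq := lyq / lZ with hsq
  have hSγ : 16 / (15 * γ) = (16 / 15) / γ := by rw [div_div]
  have hsu_lo : 2 ≤ su := by
    rw [hsu, le_div_iff₀ hlZ0]
    have := Real.log_le_log hZ0 hZMN
    rw [Real.log_rpow hMN0] at this
    linarith
  have hsq_lo : 1 / 10 < sq := by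
    rw [hsq, lt_div_iff₀ hlZ0]; linarith
  have hsq_hi : sq ≤ 16 / (15 * γ) := by
    rw [hsq, div_le_iff₀ hlZ0, hSγ, div_mul_eq_mul_div, le_div_iff₀ hγ]
    calc lyq * γ ≤ 16 / 15 * L * γ := mul_le_mul_of_nonneg_right hlyq_hi hγ.le
      _ = 16 / 15 * (γ * L) := by ring
      _ ≤ 16 / 15 * lZ := mul_le_mul_of_nonneg_left hlZ_lo (by norm_num)
  have hsu_hi : su ≤ 16 / (15 * γ) := by
    rw [hsu, div_le_iff₀ hlZ0, hSγ, div_mul_eq_mul_div, le_div_iff₀ hγ]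
    calc lMN * γ ≤ 16 / 15 * L * γ := mul_le_mul_of_nonneg_right (hMN.2.trans hlyq_hi) hγ.le
      _ = 16 / 15 * (γ * L) := by ring
      _ ≤ 16 / 15 * lZ := mul_le_mul_of_nonneg_left hlZ_lo (by norm_num)
  have hsq_mem : sq ∈ Set.Icc (1 / 10 : ℝ) (16 / (15 * γ) + 2) := ⟨hsq_lo.le, by linarith⟩
  have hsu_mem : su ∈ Set.Icc (1 / 10 : ℝ) (16 / (15 * γ) + 2) := ⟨by linarith, by linarith⟩
  have hsq0 : 0 < sq := by linarith
  have hfsu : 0 ≤ f su := (hFf.nonneg (by linarith : (0 : ℝ) < su)).2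
  have hfsq : 0 ≤ f sq := (hFf.nonneg hsq0).2
  have hfsq_le : f sq ≤ fmax := (le_abs_self _).trans (hfmax sq hsq_mem)
  have hLf0 : (0 : ℝ) ≤ Lf := NNReal.coe_nonneg _
  -- `|su − sq| ≤ ε/γ`, hence `f(su) ≥ f(sq) − L_f ε/γ`
  have hdiff : |su - sq| ≤ ε / γ := by
    have e : su - sq = (lMN - lyq) / lZ := by rw [hsu, hsq]; field_simp
    rw [e, abs_div, abs_of_pos hlZ0, div_le_div_iff₀ hlZ0 hγ]
    have habs : |lMN - lyq| ≤ 6 * ε' * L := by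
      have h6 : 0 ≤ 6 * ε' * L := by positivity
      rw [abs_le]; constructor <;> linarith [hMN.1, hMN.2]
    calc |lMN - lyq| * γ ≤ 6 * ε' * L * γ := mul_le_mul_of_nonneg_right habs hγ.le
      _ = 6 * ε' * (γ * L) := by ring
      _ ≤ ε * (γ * L) := mul_le_mul_of_nonneg_right (by linarith) hγL.le
      _ ≤ ε * lZ := mul_le_mul_of_nonneg_left hlZ_lo hε.le
  have hfdiff : f sq - Lf * ε / γ ≤ f su := by
    have hLd := hLip.dist_le_mul sq hsq_mem su hsu_mem
    rw [Real.dist_eq, Real.dist_eq, abs_sub_comm sq su] at hLd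
    have : f sq - f su ≤ Lf * (ε / γ) :=
      (le_abs_self _).trans (hLd.trans (mul_le_mul_of_nonneg_left hdiff hLf0))
    have e2 : (Lf : ℝ) * (ε / γ) = Lf * ε / γ := by ring
    linarith
  -- assemble: `V(Z) f(su) = ΛZ f(su)/lZ`
  have hV : densityProd Z = ΛZ / lZ := by rw [hΛZ_def]; field_simp
  rw [hV, div_mul_eq_mul_div, div_mul_eq_mul_div, div_le_div_iff_of_pos_right hlZ0]
  -- goal: `Λz * (f sq − C ε) ≤ ΛZ * f su`
  have hC0 : 0 ≤ (Lf : ℝ) / γ + fmax := by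
    have : 0 ≤ fmax := hfsq.trans hfsq_le
    positivity
  rcases le_or_gt (f sq - Lf * ε / γ) 0 with hneg | hpos
  · -- the target is nonpositive
    have h1 : f sq - (Lf / γ + fmax) * ε ≤ 0 := by
      have : Lf * ε / γ ≤ (Lf / γ + fmax) * ε := by
        have : 0 ≤ fmax * ε := mul_nonneg (hfsq.trans hfsq_le) hε.le
        have e : (Lf : ℝ) * ε / γ = Lf / γ * ε := by ring
        have e2 : ((Lf : ℝ) / γ + fmax) * ε = Lf / γ * ε + fmax * ε := by ring
        linarith
      linarith
    calc Λz * (f sq - (Lf / γ + fmax) * ε) ≤ 0 := mul_nonpos_of_nonneg_of_nonpos hΛz0.le h1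
      _ ≤ ΛZ * f su := mul_nonneg hΛZ0 hfsu
  · calc Λz * (f sq - (Lf / γ + fmax) * ε)
        ≤ Λz * (1 - ε / 4) * (f sq - Lf * ε / γ) := by
          have e : Λz * (1 - ε / 4) * (f sq - Lf * ε / γ) =
              Λz * (f sq - Lf / γ * ε - ε / 4 * (f sq - Lf * ε / γ)) := by ring
          rw [e]
          refine mul_le_mul_of_nonneg_left ?_ hΛz0.le
          have : ε / 4 * (f sq - Lf * ε / γ) ≤ fmax * ε := by
            have h3 : f sq - Lf * ε / γ ≤ fmax := by
              have : 0 ≤ (Lf : ℝ) * ε / γ := by positivity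
              linarith
            have h4 : ε / 4 * (f sq - Lf * ε / γ) ≤ ε * (f sq - Lf * ε / γ) :=
              mul_le_mul_of_nonneg_right (by linarith) hpos.le
            have h5 : ε * (f sq - Lf * ε / γ) ≤ ε * fmax := mul_le_mul_of_nonneg_left h3 hε.le
            linarith
          have e2 : ((Lf : ℝ) / γ + fmax) * ε = Lf / γ * ε + fmax * ε := by ring
          linarith
      _ ≤ ΛZ * f su := mul_le_mul hΛZz hfdiff hpos.le hΛZ0

set_option maxHeartbeats 400000 in
/-- **Lower bound, the case `Z > (MN)^{1/2}`** (then `s = log(y/q)/log Z < 2 + 360ε'`, so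
`f(s) ≤ 360 L_f ε'` and the claimed main term is nonpositive; `S ≥ 0` suffices).
[cite: IwaniecInventiones1978, Proposition 2] -/
theorem main_term_lower_trivial {F f : ℝ → ℝ} (hFf : IsLinearSieveFunctions F f) {γ : ℝ}
    (hγ : 0 < γ) (hγ2 : γ < 1 / 2) {Lf : NNReal} {fmax : ℝ}
    (hLip : LipschitzOnWith Lf f (Set.Icc (1 / 10) (16 / (15 * γ) + 2)))
    (hfmax : ∀ s ∈ Set.Icc (1 / 10 : ℝ) (16 / (15 * γ) + 2), |f s| ≤ fmax)
    {ε ε' x Z MN : ℝ} {q : ℕ} (hε : 0 < ε) (hε1 : ε ≤ 1) (hε' : 0 ≤ ε') (hε'ε : ε' ≤ ε / 1000)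
    (hx : 1 < x) (hZ : x ^ γ ≤ Z ∧ Z < x ^ (1 / 2 : ℝ)) (hq : 1 ≤ q ∧ (q : ℝ) < x ^ (1 - ε))
    (hMN0 : 0 < MN) (hZMN : MN ^ (1 / 2 : ℝ) < Z)
    (hMN : Real.log (x ^ (16 / 15 : ℝ) / q) - 6 * ε' * Real.log x ≤ Real.log MN) :
    densityProd (x ^ γ) * Real.log (x ^ γ) / Real.log Z *
        (f (Real.log (x ^ (16 / 15 : ℝ) / q) / Real.log Z) - (Lf / γ + fmax) * ε) ≤ 0 := by
  have hx0 : 0 < x := by linarith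
  set L := Real.log x with hL
  have hL0 : 0 < L := Real.log_pos hx
  have hεL : 0 < ε * L := mul_pos hε hL0
  have hlz : Real.log (x ^ γ) = γ * L := Real.log_rpow hx0 γ
  have hγL : 0 < γ * L := mul_pos hγ hL0
  have hq0 : (0 : ℝ) < q := by exact_mod_cast hq.1
  have hq1 : (1 : ℝ) ≤ q := by exact_mod_cast hq.1
  set lyq := Real.log (x ^ (16 / 15 : ℝ) / q) with hlyq
  have hlyq_eq : lyq = 16 / 15 * L - Real.log q := by
    rw [hlyq, Real.log_div (by positivity) hq0.ne', Real.log_rpow hx0]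
  have hlogq0 : 0 ≤ Real.log q := Real.log_nonneg hq1
  have hlogq : Real.log q < (1 - ε) * L := by
    rw [← Real.log_rpow hx0]; exact Real.log_lt_log hq0 hq.2
  have hlyq_lo : L / 15 < lyq := by rw [hlyq_eq]; linarith
  have hlyq_hi : lyq ≤ 16 / 15 * L := by rw [hlyq_eq]; linarith
  have hlyq0 : 0 < lyq := lt_trans (by positivity) hlyq_lo
  have hZ0 : 0 < Z := lt_of_lt_of_le (Real.rpow_pos_of_pos hx0 γ) hZ.1
  set lZ := Real.log Z with hlZ
  have hlZ_lo : γ * L ≤ lZ := by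
    rw [← hlz]; exact Real.log_le_log (Real.rpow_pos_of_pos hx0 γ) hZ.1
  have hlZ0 : 0 < lZ := lt_of_lt_of_le hγL hlZ_lo
  set lMN := Real.log MN with hlMN
  have hε'L : 6 * ε' * L ≤ 90 * ε' * lyq := by
    have := mul_le_mul_of_nonneg_left (show L ≤ 15 * lyq by linarith) (show 0 ≤ 6 * ε' by positivity)
    linarith
  have hlMN_lo : lyq * (1 - 90 * ε') ≤ lMN := by linarith
  have h90 : 90 * ε' ≤ 9 / 100 := by linarith
  -- `lZ > lMN/2`, so `sq = lyq/lZ < 2 lyq/lMN ≤ 2/(1 − 90ε') ≤ 2 + 360 ε'`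
  have hsqrt0 : 0 < MN ^ (1 / 2 : ℝ) := Real.rpow_pos_of_pos hMN0 _
  have hlZ_gt : lMN / 2 < lZ := by
    have := Real.log_lt_log hsqrt0 hZMN
    rw [Real.log_rpow hMN0] at this; linarith
  set sq := lyq / lZ with hsq
  have hsq0 : 0 < sq := div_pos hlyq0 hlZ0
  have hsq_lo : 1 / 10 < sq := by
    rw [hsq, lt_div_iff₀ hlZ0]
    have : lZ < L / 2 := by
      have := Real.log_lt_log hZ0 hZ.2
      rw [Real.log_rpow hx0] at this; linarith
    linarith
  have hsq_hi : sq ≤ 2 + 360 * ε' := by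
    rw [hsq, div_le_iff₀ hlZ0]
    -- `lyq ≤ (2 + 360ε') lZ` since `lyq (1 − 90ε') ≤ lMN < 2 lZ` and `1/(1−90ε') ≤ 1 + 180 ε'`
    have h1 : lyq ≤ lMN * (1 + 180 * ε') := by
      have hh := one_div_one_sub_le (by positivity : 0 ≤ 90 * ε') (by linarith)
      have hlyq91 : lyq * (91 / 100) ≤ lyq * (1 - 90 * ε') :=
        mul_le_mul_of_nonneg_left (by linarith) hlyq0.le
      have hlMN0 : 0 < lMN :=
        lt_of_lt_of_le (by positivity : 0 < lyq * (91 / 100)) (hlyq91.trans hlMN_lo)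
      have h2 : lyq ≤ lMN * (1 / (1 - 90 * ε')) := by
        rw [mul_one_div, le_div_iff₀ (by linarith)]; linarith
      exact h2.trans (mul_le_mul_of_nonneg_left (by linarith) hlMN0.le)
    have h3 : lMN * (1 + 180 * ε') ≤ 2 * lZ * (1 + 180 * ε') :=
      mul_le_mul_of_nonneg_right (by linarith) (by positivity)
    have e : 2 * lZ * (1 + 180 * ε') = (2 + 360 * ε') * lZ := by ring
    linarith
  have hΛz0 : 0 ≤ densityProd (x ^ γ) * Real.log (x ^ γ) / lZ :=
    div_nonneg (mul_nonneg (densityProd_pos _).le (by rw [hlz]; positivity)) hlZ0.le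
  refine mul_nonpos_of_nonneg_of_nonpos hΛz0 ?_
  -- `f(sq) ≤ 360 L_f ε' ≤ (L_f/γ + fmax) ε`
  have hLf0 : (0 : ℝ) ≤ Lf := NNReal.coe_nonneg _
  have hfmax0 : 0 ≤ fmax := by
    have h2mem : (2 : ℝ) ∈ Set.Icc (1 / 10 : ℝ) (16 / (15 * γ) + 2) := by
      constructor
      · norm_num
      · have : 0 < 16 / (15 * γ) := by positivity
        linarith
    have := hfmax 2 h2mem
    rw [hFf.lower_eq_zero two_pos le_rfl, abs_zero] at this
    exact this
  have hfsq : f sq ≤ 360 * Lf * ε' := by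
    rcases le_or_gt sq 2 with h2 | h2
    · rw [hFf.lower_eq_zero hsq0 h2]; positivity
    · have hSγ2 : (2 : ℝ) + 360 * ε' ≤ 16 / (15 * γ) + 2 := by
        have : (2 : ℝ) ≤ 16 / (15 * γ) := by
          rw [div_eq_mul_inv, le_mul_inv_iff₀ (by positivity)]; linarith
        linarith
      have hsq_mem : sq ∈ Set.Icc (1 / 10 : ℝ) (16 / (15 * γ) + 2) := ⟨hsq_lo.le, by linarith⟩
      have h2mem : (2 : ℝ) ∈ Set.Icc (1 / 10 : ℝ) (16 / (15 * γ) + 2) :=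
        ⟨by norm_num, by linarith⟩
      have hLd := hLip.dist_le_mul sq hsq_mem 2 h2mem
      rw [Real.dist_eq, Real.dist_eq, hFf.lower_eq_zero two_pos le_rfl, sub_zero,
        abs_of_pos (by linarith : 0 < sq - 2)] at hLd
      calc f sq ≤ |f sq| := le_abs_self _
        _ ≤ Lf * (sq - 2) := hLd
        _ ≤ Lf * (360 * ε') := mul_le_mul_of_nonneg_left (by linarith) hLf0
        _ = 360 * Lf * ε' := by ring
  have : 360 * Lf * ε' ≤ (Lf / γ + fmax) * ε := by
    have h1 : 360 * (Lf : ℝ) * ε' ≤ Lf * ε := by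
      have := mul_le_mul_of_nonneg_left hε'ε (by positivity : 0 ≤ 360 * (Lf : ℝ))
      have h0 : 0 ≤ (Lf : ℝ) * ε := by positivity
      linarith
    have h2 : (Lf : ℝ) * ε ≤ Lf / γ * ε := by
      refine mul_le_mul_of_nonneg_right ?_ hε.le
      rw [le_div_iff₀ hγ]
      exact mul_le_of_le_one_right hLf0 (by linarith)
    have h3 : 0 ≤ fmax * ε := by positivity
    have e : ((Lf : ℝ) / γ + fmax) * ε = Lf / γ * ε + fmax * ε := by ring
    linarith
  linarith


/-! ### Dyadic classes: floors, counting, and the asymptotic size conditions -/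

/-- The dyadic floor of `r ≥ 1`: with `j = ⌊log₂ ⌊r⌋⌋`, `2^j ≤ r < 2 · 2^j`. [folklore] -/
theorem dyadicFloor_spec {r : ℝ} (hr : 1 ≤ r) :
    (2 : ℝ) ^ Nat.log 2 ⌊r⌋₊ ≤ r ∧ r < 2 * (2 : ℝ) ^ Nat.log 2 ⌊r⌋₊ := by
  have hfl : 1 ≤ ⌊r⌋₊ := Nat.le_floor (by simpa using hr)
  constructor
  · have h1 : (2 : ℕ) ^ Nat.log 2 ⌊r⌋₊ ≤ ⌊r⌋₊ := Nat.pow_log_le_self 2 (by omega)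
    calc (2 : ℝ) ^ Nat.log 2 ⌊r⌋₊ = ((2 ^ Nat.log 2 ⌊r⌋₊ : ℕ) : ℝ) := by push_cast; ring
      _ ≤ (⌊r⌋₊ : ℝ) := by exact_mod_cast h1
      _ ≤ r := Nat.floor_le (by linarith)
  · have h2 : ⌊r⌋₊ < 2 ^ (Nat.log 2 ⌊r⌋₊ + 1) := Nat.lt_pow_succ_log_self (by norm_num) _
    have h3 : ⌊r⌋₊ + 1 ≤ 2 ^ (Nat.log 2 ⌊r⌋₊ + 1) := h2
    calc r < (⌊r⌋₊ : ℝ) + 1 := Nat.lt_floor_add_one r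
      _ = ((⌊r⌋₊ + 1 : ℕ) : ℝ) := by push_cast; ring
      _ ≤ ((2 ^ (Nat.log 2 ⌊r⌋₊ + 1) : ℕ) : ℝ) := by exact_mod_cast h3
      _ = 2 * (2 : ℝ) ^ Nat.log 2 ⌊r⌋₊ := by push_cast; ring

/-- If `2^k ≤ x` then `k ≤ ⌊log₂ x⌋`. [folklore] -/
theorem le_floor_logb_of_pow_le {k : ℕ} {x : ℝ} (hx : 0 < x) (h : (2 : ℝ) ^ k ≤ x) :
    k ≤ ⌊Real.logb 2 x⌋₊ := by
  refine Nat.le_floor ?_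
  have : ((k : ℕ) : ℝ) ≤ Real.logb 2 x := by
    rw [Real.le_logb_iff_rpow_le (by norm_num) hx]
    exact_mod_cast h
  exact this

/-- `⌊log₂ x⌋ ≤ 2 log x` for `x ≥ 1`. [folklore] -/
theorem floor_logb_le (x : ℝ) (hx : 1 ≤ x) : (⌊Real.logb 2 x⌋₊ : ℝ) ≤ 2 * Real.log x := by
  have hlog2 : 1 / 2 ≤ Real.log 2 := by have := Real.log_two_gt_d9; linarith
  have hlx : 0 ≤ Real.log x := Real.log_nonneg hx
  have h1 : Real.logb 2 x ≤ 2 * Real.log x := by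
    rw [Real.logb, div_le_iff₀ (by linarith)]; nlinarith
  have h0 : 0 ≤ Real.logb 2 x := Real.logb_nonneg (by norm_num) hx
  exact (Nat.floor_le h0).trans h1

/-- **The remainder is negligible for large `x`**: for `A ≥ 0`, `κ > 0`, `ε' > 0` and all large
`x`, `(⌊log₂ x⌋ + 1)² A x^{1−ε'} ≤ κ x / log x` (p. 186: the `≤ 4 (log x)²` classes times
`O_ε(2^{η^{-10}} x^{1−ε})`). [cite: IwaniecInventiones1978, §5 p. 186] -/
theorem eventually_classes_remainder_le {A κ ε' : ℝ} (hA : 0 ≤ A) (hκ : 0 < κ) (hε' : 0 < ε') :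
    ∀ᶠ x : ℝ in atTop, ((⌊Real.logb 2 x⌋₊ : ℝ) + 1) ^ 2 * A * x ^ (1 - ε') ≤ κ * x / Real.log x := by
  have hlo := (isLittleO_log_rpow_rpow_atTop 3 hε').bound (show 0 < κ / (9 * A + 1) by positivity)
  filter_upwards [hlo, eventually_ge_atTop (Real.exp 1)] with x hx hxe
  have hx0 : 0 < x := lt_of_lt_of_le (Real.exp_pos 1) hxe
  have hx1 : 1 ≤ Real.log x := by rwa [Real.le_log_iff_exp_le hx0]
  have hxpos : 0 < x ^ ε' := Real.rpow_pos_of_pos hx0 _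
  rw [Real.norm_of_nonneg (Real.rpow_nonneg (by linarith) _), Real.norm_of_nonneg hxpos.le,
    show (3 : ℝ) = ((3 : ℕ) : ℝ) by norm_num, Real.rpow_natCast] at hx
  have hfl := floor_logb_le x (by linarith [Real.add_one_le_exp (1 : ℝ)])
  -- `(⌊log₂ x⌋+1)² ≤ 9 (log x)²`
  have h1 : ((⌊Real.logb 2 x⌋₊ : ℝ) + 1) ^ 2 ≤ 9 * Real.log x ^ 2 := by nlinarith
  -- `9 A (log x)² x^{1−ε'} log x ≤ κ x`
  rw [le_div_iff₀ (by linarith), Real.rpow_sub hx0, Real.rpow_one]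
  have h2 : 9 * A * Real.log x ^ 3 ≤ κ * x ^ ε' := by
    calc 9 * A * Real.log x ^ 3 ≤ (9 * A + 1) * Real.log x ^ 3 := by nlinarith [pow_nonneg (by linarith : 0 ≤ Real.log x) 3]
      _ ≤ (9 * A + 1) * (κ / (9 * A + 1) * x ^ ε') := mul_le_mul_of_nonneg_left hx (by positivity)
      _ = κ * x ^ ε' := by field_simp
  calc ((⌊Real.logb 2 x⌋₊ : ℝ) + 1) ^ 2 * A * (x / x ^ ε') * Real.log x
      ≤ 9 * Real.log x ^ 2 * A * (x / x ^ ε') * Real.log x := by gcongr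
    _ = 9 * A * Real.log x ^ 3 * x / x ^ ε' := by ring
    _ ≤ κ * x ^ ε' * x / x ^ ε' := by gcongr
    _ = κ * x := by field_simp

/-- **Lemma 2's `E` is `O(ε)` for large `x`**: `ε₂⁻⁸ e^{K+9} (log T)^{−1/3} ≤ η` for all `T` with
`log T ≥ log x / 16`, eventually in `x`. [folklore] -/
theorem eventually_E_small {B η : ℝ} (hB : 0 ≤ B) (hη : 0 < η) :
    ∀ᶠ x : ℝ in atTop, ∀ T : ℝ, 0 < T → Real.log x / 16 ≤ Real.log T →
      B * Real.log T ^ (-(1 / 3 : ℝ)) ≤ η := by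
  have ht : Tendsto (fun x : ℝ => B * (Real.log x / 16) ^ (-(1 / 3 : ℝ))) atTop (𝓝 0) := by
    have h1 : Tendsto (fun x : ℝ => Real.log x / 16) atTop atTop :=
      Real.tendsto_log_atTop.atTop_div_const (by norm_num)
    have h2 : Tendsto (fun y : ℝ => y ^ (-(1 / 3 : ℝ))) atTop (𝓝 0) :=
      tendsto_rpow_neg_atTop (by norm_num)
    simpa using (h2.comp h1).const_mul B
  filter_upwards [ht.eventually (ge_mem_nhds hη), eventually_gt_atTop (1 : ℝ)] with x hx hx1 T hT0 hT
  have hlx : 0 < Real.log x / 16 := by have := Real.log_pos hx1; positivity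
  calc B * Real.log T ^ (-(1 / 3 : ℝ)) ≤ B * (Real.log x / 16) ^ (-(1 / 3 : ℝ)) := by
        refine mul_le_mul_of_nonneg_left ?_ hB
        exact Real.rpow_le_rpow_of_nonpos hlx hT (by norm_num)
    _ ≤ η := hx

end Literature.NumberTheory.Sieve.Iwaniec1978

end
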